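import Literature.Barriers.Parity.SiegelZeroPrimePairsWeakThirdRate
import HarnessLib

/-!
# Matomäki–Merikoski, Corollary 1.1(i) from the core of Theorem 1.3 for shifts `h ≤ A` only

Sibling of `Literature/Barriers/Parity/SiegelZeroPrimePairsWeakThirdRate.lean` (Corollary 1.1(i) of
Matomäki–Merikoski, IMRN 2023, arXiv:2112.11412, from the core smoothed form of Theorem 1.3 with a general
third rate). Everything here is PROVED; no definition and no named fact is introduced. The reductions of the
sibling (and of `…SmoothedClassical.lean`, `…DyadicSmoothing.lean`, `…Degenerate.lean`) carry the range of the
shift of Theorem 1.3, `1 ≤ h ≤ AX` (so `h ≤ 3A x^{1+1/3999}` at the dyadic scales `x ≥ X^{3999/4000}/2`).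
For Corollary 1.1(i) the shift is FIXED and the constants may depend on it: applying Theorem 1.3 with `A = h`
one only ever needs the bound for `1 ≤ h ≤ A` with `K = K(C, A)`. This file records the whole chain in that
"small-shift" form (proofs verbatim, the hypothesis `h ≤ A·(…)` being simply weaker to carry):

* `MMSmoothing.pairCorrelation_smallShift_of_smoothed_generic₃`, `MMSmoothing.smoothed_smallShift_of_core_generic₃`,
  `MatomakiMerikoski2023_fixedShift_of_weakPairCorrelation_smallShift`,
  `MatomakiMerikoski2023_pairCorrelation_smallShift_of_smoothed₃`, `MatomakiMerikoski2023_smoothed_smallShift_of_core₃`,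
  `MatomakiMerikoski2023_fixedShift_of_core_smallShift`, `MatomakiMerikoski2023_fixedShift_of_core_smallShift_rpow`
  (**all proved**).

The point (scope): with `h ≤ A` the quantities `N + h`, `log(N + h)` of the error terms of §2/§7 (tree:
`MatomakiMerikoski2023_eq26`, `…CnHalf`, `…CnTau`) are `≍_A N`, `log N`, whereas for `h` as large as
`x^{1+1/3999}` the structural bound of `SiegelZeroPrimePairsCnTau.lean` is only `∝ N + h`. So the target for a
proof of Corollary 1.1(i) through §§5–7 of the source with the tree's substitutes for Lemma 2.1 is
`MatomakiMerikoski2023_fixedShift_of_core_smallShift_rpow`: the core smoothed bound for even `h ≤ A`,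
`η ≥ η₀(C, A)`, third rate `V' η^{κ−1}`.

## References

* K. Matomäki, J. Merikoski, IMRN 2023:23, 20337–20384 (arXiv:2112.11412): Corollary 1.1(i), Theorem 1.3,
  the deduction after Theorem 1.4 (p. 4), §2, §7 first paragraph. [cite: MatomakiMerikoski2023, Corollary 1.1(i), §2, §7]
* H. L. Montgomery, R. C. Vaughan, *Multiplicative Number Theory I*, Cambridge 2007, Cor. 11.15 (Siegel's
  theorem; tree: `Literature.NumberTheory.LFunctions.Siegel.exists_one_sub_realZero_ge`).
  [cite: MontgomeryVaughan2007, Corollary 11.15]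
-/

noncomputable section

open Finset Real
open scoped ArithmeticFunction.vonMangoldt

namespace Literature.Barriers.Parity

open Literature.NumberTheory.Sieve (goldbachSingularSeries plateauCutoff
  plateauCutoff_nonneg plateauCutoff_le_one sub_le_integral_plateauCutoff integral_plateauCutoff_le)
open Literature.NumberTheory.Sieve.PrimePairsVonMangoldt (sum_vonMangoldt_mul_shift_le
  sum_vonMangoldt_mul_shift_le_of_odd)

namespace MMSmoothing

set_option maxHeartbeats 800000 in
/-- **The dyadic smoothing reduction (general second and third rates) for shifts bounded by a CONSTANT.**
As `MMSmoothing.pairCorrelation_of_smoothed_generic₃` (proof verbatim), with the range of the shift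
`1 ≤ h ≤ 3A x^{1+1/3999}` in the hypothesis and `1 ≤ h ≤ AX` in the conclusion both replaced by `1 ≤ h ≤ A`:
for Corollary 1.1(i) of the source the shift is FIXED, and the constants may depend on it, so Theorem 1.3 is
only needed for `h ≤ A` with `K = K(C, A)` (take `A = h`). The dyadic blocks `x ∈ [X^{3999/4000}/2, X/2]`
inherit the same bound `h ≤ A`. [cite: MatomakiMerikoski2023, §2] -/
theorem pairCorrelation_smallShift_of_smoothed_generic₃ {C A K' Kabs : ℝ} (hC : 0 ≤ C) (hA : 0 < A)
    {ρ : ℝ → ℝ} (hρ : ∀ η : ℝ, 10 ≤ η → 0 ≤ ρ η)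
    (hK' : 0 < K') (hKabs : 0 < Kabs) {Rh Rc : ℝ → ℝ} (hRc0 : ∀ X : ℝ, 3 ≤ X → 0 ≤ Rc X)
    (hR : ∀ x X : ℝ, 1024 ≤ X → 0.89 * Real.log X ≤ Real.log x → Real.log x ≤ Real.log X →
      Rh x ≤ Rc X)
    (Habs : ∀ X : ℝ, 3 ≤ X → X ^ (-(1 / 8000 : ℝ)) ≤ Kabs * Rc X)
    (H' : ∀ (q : ℕ) [NeZero q], 3 ≤ q → ∀ χ : DirichletCharacter ℂ q, χ.IsPrimitive → χ.IsQuadratic →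
        ∀ η : ℝ, 10 ≤ η → χ.LFunction ((1 - 1 / (η * Real.log q) : ℝ) : ℂ) = 0 →
          ∀ x : ℝ, (q : ℝ) ^ (37 / 4 : ℝ) ≤ x →
            ∀ δ : ℝ, x ^ (-(1 / 999 : ℝ)) / 4 ≤ δ → δ ≤ x ^ (-(1 / 1000 : ℝ)) → δ ≤ 1 / 2 →
            ∀ h : ℕ, 1 ≤ h → (h : ℝ) ≤ A →
              |(∑ n ∈ Icc 1 ⌊2 * x⌋₊,
                  plateauCutoff (1 + δ) (2 - δ) δ (n / x) * (Λ n * Λ (n + h))) -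
                  x * (∫ u, plateauCutoff (1 + δ) (2 - δ) δ u) * goldbachSingularSeries h *
                    (1 + if Nat.totient (2 ^ padicValNat 2 q) ∣ h then
                          (-1 : ℝ) ^ (h / Nat.totient (2 ^ padicValNat 2 q)) *
                            ∏ p ∈ (q / 2 ^ padicValNat 2 q).primeFactors.filter (fun p => ¬ p ∣ h),
                              (-1 : ℝ) / ((p : ℝ) - 2)
                        else 0)| ≤
                K' * ((h : ℝ) / (Nat.totient h : ℝ)) * x *
                  (Real.exp (-(2 * C) * Real.sqrt (Real.log x / Real.log q * Real.log η)) +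
                    Rh x + Real.log x / Real.log q * ρ η)) :
    ∀ (q : ℕ) [NeZero q], 2 ≤ q → ∀ χ : DirichletCharacter ℂ q, χ.IsPrimitive → χ.IsQuadratic →
      ∀ η : ℝ, 10 ≤ η → χ.LFunction ((1 - 1 / (η * Real.log q) : ℝ) : ℂ) = 0 →
        ∀ V X : ℝ, 10 ≤ V → X = (q : ℝ) ^ V → ∀ h : ℕ, 1 ≤ h → (h : ℝ) ≤ A →
          |(∑ n ∈ Icc 1 ⌊X⌋₊, Λ n * Λ (n + h)) -
              X * goldbachSingularSeries h *
                (1 + if Nat.totient (2 ^ padicValNat 2 q) ∣ h then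
                      (-1 : ℝ) ^ (h / Nat.totient (2 ^ padicValNat 2 q)) *
                        ∏ p ∈ (q / 2 ^ padicValNat 2 q).primeFactors.filter (fun p => ¬ p ∣ h),
                          (-1 : ℝ) / ((p : ℝ) - 2)
                    else 0)| ≤
            (K' + 30 * 24000 ^ 3 * (3 + A) * Kabs) * ((h : ℝ) / (Nat.totient h : ℝ)) * X *
              (Real.exp (-C * Real.sqrt (V * Real.log η)) + Rc X + V * ρ η) := by
  intro q _ hq χ hprim hquad η hη hL V X hV hX h hh hhAc
  set KA : ℝ := 30 * 24000 ^ 3 * (3 + A) with hKA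
  have hKA0 : 0 < KA := by positivity
  -- `q = 2` carries no primitive character
  by_cases hq2eq : q = 2
  · subst hq2eq; exact absurd hprim (not_isPrimitive_level_two χ)
  have hq3 : 3 ≤ q := by omega
  have hq3' : (3 : ℝ) ≤ q := by exact_mod_cast hq3
  -- the correction factor and the singular series
  set corr : ℝ := (if Nat.totient (2 ^ padicValNat 2 q) ∣ h then
      (-1 : ℝ) ^ (h / Nat.totient (2 ^ padicValNat 2 q)) *
        ∏ p ∈ (q / 2 ^ padicValNat 2 q).primeFactors.filter (fun p => ¬ p ∣ h),
          (-1 : ℝ) / ((p : ℝ) - 2)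
      else 0) with hcorr_def
  have hcorr : |corr| ≤ 1 := abs_corr_le_one q h
  have hcorr1 : |1 + corr| ≤ 2 := by
    have := abs_add_le (1 : ℝ) corr; rw [abs_one] at this; linarith
  set hφ : ℝ := (h : ℝ) / (Nat.totient h : ℝ) with hhφ
  have hh0 : h ≠ 0 := by omega
  have hφpos : (0 : ℝ) < Nat.totient h := by exact_mod_cast Nat.totient_pos.mpr (by omega)
  have hhφ1 : 1 ≤ hφ := by rw [hhφ, le_div_iff₀ hφpos, one_mul]; exact_mod_cast Nat.totient_le h
  set 𝔖 : ℝ := goldbachSingularSeries h with h𝔖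
  have h𝔖0 : 0 ≤ 𝔖 := Literature.NumberTheory.Sieve.SingularSeriesMean.goldbachSingularSeries_nonneg h
  have h𝔖le : 𝔖 ≤ 6 * hφ := goldbachSingularSeries_le_mul_div_totient hh0
  -- basic sizes
  have hq2 : (2 : ℝ) ≤ q := by exact_mod_cast hq
  have hq0 : (0 : ℝ) < q := by linarith
  have hq1 : (1 : ℝ) ≤ q := by linarith
  have hlogq : 0 < Real.log q := Real.log_pos (by linarith)
  have hlog2 : Real.log 2 ≤ Real.log q := Real.log_le_log two_pos hq2
  have hlog2pos : 0 < Real.log 2 := Real.log_pos one_lt_two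
  have hV0 : 0 < V := by linarith
  have hX0 : 0 < X := by rw [hX]; exact Real.rpow_pos_of_pos hq0 V
  have hlogX : Real.log X = V * Real.log q := by rw [hX, Real.log_rpow hq0]
  have hlogXge : 10 * Real.log 2 ≤ Real.log X := by
    rw [hlogX]; exact mul_le_mul hV hlog2 hlog2pos.le (by linarith)
  have hlogX0 : 0 < Real.log X := by linarith only [hlogXge, hlog2pos]
  have hlog2d : (0.6931471803 : ℝ) < Real.log 2 := Real.log_two_gt_d9
  have hX1024 : (1024 : ℝ) ≤ X := by
    have h1 : Real.log 1024 = 10 * Real.log 2 := by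
      rw [show (1024 : ℝ) = 2 ^ 10 by norm_num, Real.log_pow]; norm_num
    have h2 : Real.log 1024 ≤ Real.log X := by rw [h1]; exact hlogXge
    exact (Real.log_le_log_iff (by norm_num) hX0).mp h2
  have hX3 : (3 : ℝ) ≤ X := by linarith
  have hX1 : (1 : ℝ) ≤ X := by linarith
  have hhA : (h : ℝ) ≤ A * X := hhAc.trans (le_mul_of_one_le_right hA.le hX1)
  have hVeq : V = Real.log X / Real.log q := by rw [hlogX]; field_simp
  -- the summand and its trivial bound
  set a : ℕ → ℝ := fun n => Λ n * Λ (n + h) with ha_def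
  have ha0 : ∀ n, 0 ≤ a n := fun n => vonMangoldt_mul_nonneg n (n + h)
  set L : ℝ := Real.log ((3 + A) * X) with hL_def
  have h3AX : 3 ≤ (3 + A) * X := by
    have e : (3 + A) * X = 3 * X + A * X := by ring
    have hAX : 0 ≤ A * X := by positivity
    rw [e]; linarith only [hX1, hAX]
  have hL1 : 1 ≤ L := by
    rw [hL_def, ← Real.log_exp 1]
    refine Real.log_le_log (Real.exp_pos 1) (le_trans ?_ h3AX)
    linarith [Real.exp_one_lt_d9]
  have hL0 : 0 < L := by linarith
  have haL : ∀ n : ℕ, 1 ≤ n → (n : ℝ) ≤ 2 * X → a n ≤ L ^ 2 := by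
    intro n hn1 hn2
    refine vonMangoldt_mul_le_log_sq ?_ hn1
    have e : (3 + A) * X = 2 * X + A * X + X := by ring
    rw [e]
    linarith only [hn2, hhA, hX0]
  -- the parameters `δ` and `J`
  set δ : ℝ := X ^ (-(1 / 1000 : ℝ)) / 2 with hδ_def
  have hXpow : X ^ (-(1 / 1000 : ℝ)) ≤ 1 := Real.rpow_le_one_of_one_le_of_nonpos hX1 (by norm_num)
  have hXpow0 : 0 < X ^ (-(1 / 1000 : ℝ)) := Real.rpow_pos_of_pos hX0 _
  have hδ0 : 0 < δ := by positivity
  have hδhalf : δ ≤ 1 / 2 := by rw [hδ_def]; linarith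
  have hδX : 2 * δ * X = X ^ (999 / 1000 : ℝ) := by
    rw [hδ_def, show (999 / 1000 : ℝ) = -(1 / 1000) + 1 by norm_num, Real.rpow_add hX0, Real.rpow_one]
    ring
  set t : ℝ := Real.log X / (4000 * Real.log 2) with ht_def
  have ht0 : 0 ≤ t := by positivity
  set J : ℕ := ⌊t⌋₊ + 1 with hJ_def
  have h2t : (2 : ℝ) ^ t = X ^ (1 / 4000 : ℝ) := by
    rw [Real.rpow_def_of_pos two_pos, Real.rpow_def_of_pos hX0, ht_def]
    congr 1; field_simp
  have h2J_gt : X ^ (1 / 4000 : ℝ) < (2 : ℝ) ^ J := by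
    rw [← h2t, ← Real.rpow_natCast 2 J]
    refine Real.rpow_lt_rpow_of_exponent_lt one_lt_two ?_
    rw [hJ_def]; push_cast; exact Nat.lt_floor_add_one t
  have h2J_le : (2 : ℝ) ^ J ≤ 2 * X ^ (1 / 4000 : ℝ) := by
    rw [← h2t, hJ_def, pow_succ, mul_comm, ← Real.rpow_natCast 2 ⌊t⌋₊]
    exact mul_le_mul_of_nonneg_left (Real.rpow_le_rpow_of_exponent_le one_le_two (Nat.floor_le ht0)) two_pos.le
  have h2J_pos : (0 : ℝ) < 2 ^ J := pow_pos two_pos J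
  have hXJ : X / 2 ^ J < X ^ (3999 / 4000 : ℝ) := by
    rw [div_lt_iff₀ h2J_pos]
    calc X = X ^ (3999 / 4000 : ℝ) * X ^ (1 / 4000 : ℝ) := by
          rw [← Real.rpow_add hX0, show (3999 / 4000 : ℝ) + 1 / 4000 = 1 by norm_num, Real.rpow_one]
      _ < X ^ (3999 / 4000 : ℝ) * 2 ^ J := mul_lt_mul_of_pos_left h2J_gt (Real.rpow_pos_of_pos hX0 _)
  have hJL : (J : ℝ) ≤ 2 * L := by
    have h1 : (J : ℝ) ≤ t + 1 := by
      rw [hJ_def]; push_cast; linarith [Nat.floor_le ht0]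
    have h2 : t ≤ Real.log X := by
      rw [ht_def, div_le_iff₀ (by positivity)]
      have h400 : (1 : ℝ) ≤ 4000 * Real.log 2 := by linarith
      exact le_mul_of_one_le_right hlogX0.le h400
    have h3 : Real.log X ≤ L := by
      rw [hL_def]; refine Real.log_le_log hX0 ?_
      have e : (3 + A) * X = X + (2 + A) * X := by ring
      have hAX : 0 ≤ (2 + A) * X := by positivity
      rw [e]; linarith only [hAX]
    linarith only [h1, h2, h3, hL1]
  -- the common error function
  set E : ℝ := Real.exp (-C * Real.sqrt (V * Real.log η)) + Rc X + V * ρ η with hE_def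
  have hη0 : 0 < η := by linarith
  have hV6 : 0 ≤ V * ρ η := mul_nonneg hV0.le (hρ η hη)
  have hRcX : 0 ≤ Rc X := hRc0 X hX3
  have hEexp : Rc X ≤ E := by
    rw [hE_def]
    linarith [Real.exp_pos (-C * Real.sqrt (V * Real.log η))]
  have hE0 : 0 ≤ E := hRcX.trans hEexp
  -- the weight and its integral
  set g : ℝ → ℝ := plateauCutoff (1 + δ) (2 - δ) δ with hg_def
  have hab : 1 + δ ≤ 2 - δ := by linarith
  set I : ℝ := ∫ u, g u with hI_def
  have hI1 : I ≤ 1 := by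
    have := integral_plateauCutoff_le hδ0 hab; rw [← hg_def] at this; linarith
  have hI2 : 1 - 2 * δ ≤ I := by
    have := sub_le_integral_plateauCutoff hδ0 hab; rw [← hg_def] at this; linarith
  have hI0 : 0 ≤ I := by linarith
  -- the blocks
  have hblock : ∀ j ∈ Finset.range J,
      |(∑ n ∈ Ioc ⌊X / 2 ^ (j + 1)⌋₊ ⌊X / 2 ^ j⌋₊, a n) -
          X / 2 ^ (j + 1) * I * 𝔖 * (1 + corr)| ≤
        (2 * δ * (X / 2 ^ (j + 1)) + 2) * L ^ 2 + K' * hφ * (X / 2 ^ (j + 1)) * E := by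
    intro j hj
    have hjJ : j + 1 ≤ J := Finset.mem_range.mp hj
    set x : ℝ := X / 2 ^ (j + 1) with hx_def
    have h2j : (0 : ℝ) < 2 ^ (j + 1) := pow_pos two_pos _
    have hx2 : 2 * x = X / 2 ^ j := by rw [hx_def, pow_succ]; field_simp
    have hxX : x ≤ X / 2 := by
      rw [hx_def, div_le_div_iff_of_pos_left hX0 h2j two_pos]
      calc (2 : ℝ) = 2 ^ 1 := by norm_num
        _ ≤ 2 ^ (j + 1) := pow_le_pow_right₀ one_le_two (by omega)
    have hxlow : X ^ (3999 / 4000 : ℝ) / 2 ≤ x := by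
      -- `x = X/2^{j+1} ≥ X/2^J ≥ X^{3999/4000}/2`
      have h1 : X / 2 ^ J ≤ x := by
        rw [hx_def]
        exact div_le_div_of_nonneg_left hX0.le h2j (pow_le_pow_right₀ one_le_two hjJ)
      have h2 : X ^ (3999 / 4000 : ℝ) / 2 ≤ X / 2 ^ J := by
        rw [div_le_div_iff₀ two_pos h2J_pos]
        calc X ^ (3999 / 4000 : ℝ) * 2 ^ J ≤ X ^ (3999 / 4000 : ℝ) * (2 * X ^ (1 / 4000 : ℝ)) :=
              mul_le_mul_of_nonneg_left h2J_le (Real.rpow_nonneg hX0.le _)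
          _ = X * 2 := by
              rw [mul_comm (2 : ℝ), ← mul_assoc, ← Real.rpow_add hX0,
                show (3999 / 4000 : ℝ) + 1 / 4000 = 1 by norm_num, Real.rpow_one]
      exact h2.trans h1
    have hX399 : 0 < X ^ (3999 / 4000 : ℝ) := Real.rpow_pos_of_pos hX0 _
    have hx0 : 0 < x := by linarith
    have hx1 : 1 ≤ x := by
      -- `X^{399/400} ≥ 1024^{399/400} ≥ 2`
      have : (2 : ℝ) ≤ X ^ (3999 / 4000 : ℝ) := by
        calc (2 : ℝ) ≤ 1024 ^ (3999 / 4000 : ℝ) := by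
              have : (2 : ℝ) = 1024 ^ (1 / 10 : ℝ) := by
                rw [show (1024 : ℝ) = 2 ^ (10 : ℝ) by norm_num, ← Real.rpow_mul (by norm_num)]; norm_num
              rw [this]
              exact Real.rpow_le_rpow_of_exponent_le (by norm_num) (by norm_num)
          _ ≤ X ^ (3999 / 4000 : ℝ) := Real.rpow_le_rpow (by norm_num) hX1024 (by norm_num)
      linarith only [this, hxlow]
    -- (x2) `q^{37/4} ≤ x` (uses `q ≥ 3`: `2 ≤ 3^{7/10} ≤ q^{7/10}`)
    have hq8 : (q : ℝ) ^ (37 / 4 : ℝ) ≤ x := by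
      have h1 : X ^ (3999 / 4000 : ℝ) = (q : ℝ) ^ (V * (3999 / 4000)) := by
        rw [hX, ← Real.rpow_mul hq0.le]
      have h2 : (q : ℝ) ^ (37 / 4 : ℝ) * 2 ≤ (q : ℝ) ^ (V * (3999 / 4000)) := by
        have h3 : (q : ℝ) ^ ((37 / 4 : ℝ) + 7 / 10) ≤ (q : ℝ) ^ (V * (3999 / 4000)) :=
          Real.rpow_le_rpow_of_exponent_le hq1 (by linarith only [hV])
        rw [Real.rpow_add hq0] at h3
        have h4 : (2 : ℝ) ≤ (q : ℝ) ^ (7 / 10 : ℝ) :=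
          calc (2 : ℝ) = ((2 : ℝ) ^ (10 : ℕ)) ^ (1 / 10 : ℝ) := by
                rw [← Real.rpow_natCast, ← Real.rpow_mul (by norm_num)]; norm_num
            _ ≤ ((3 : ℝ) ^ (7 : ℕ)) ^ (1 / 10 : ℝ) := Real.rpow_le_rpow (by norm_num) (by norm_num) (by norm_num)
            _ = (3 : ℝ) ^ (7 / 10 : ℝ) := by
                rw [← Real.rpow_natCast, ← Real.rpow_mul (by norm_num)]; norm_num
            _ ≤ (q : ℝ) ^ (7 / 10 : ℝ) := Real.rpow_le_rpow (by norm_num) hq3' (by norm_num)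
        have h5 : 0 ≤ (q : ℝ) ^ (37 / 4 : ℝ) := Real.rpow_nonneg hq0.le _
        exact (mul_le_mul_of_nonneg_left h4 h5).trans h3
      rw [← h1] at h2
      linarith only [h2, hxlow]
    -- (x3) the range of `δ`
    have hδlow : x ^ (-(1 / 999 : ℝ)) / 4 ≤ δ := by
      rw [hδ_def]
      -- `x^{-1/999} ≤ (X^{3999/4000}/2)^{-1/999} = 2^{1/999} X^{-3999/3996000} ≤ 2 X^{-1/1000}`
      have h1 : x ^ (-(1 / 999 : ℝ)) ≤ (X ^ (3999 / 4000 : ℝ) / 2) ^ (-(1 / 999 : ℝ)) :=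
        Real.rpow_le_rpow_of_nonpos (by positivity) hxlow (by norm_num)
      have h2 : (X ^ (3999 / 4000 : ℝ) / 2) ^ (-(1 / 999 : ℝ)) =
          X ^ (-(3999 / 3996000 : ℝ)) * 2 ^ (1 / 999 : ℝ) := by
        rw [Real.div_rpow (Real.rpow_nonneg hX0.le _) two_pos.le, ← Real.rpow_mul hX0.le,
          div_eq_mul_inv, ← Real.rpow_neg two_pos.le]
        norm_num
      have h3 : (2 : ℝ) ^ (1 / 999 : ℝ) ≤ 2 :=
        calc (2 : ℝ) ^ (1 / 999 : ℝ) ≤ 2 ^ (1 : ℝ) := Real.rpow_le_rpow_of_exponent_le one_le_two (by norm_num)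
          _ = 2 := Real.rpow_one 2
      have h4 : X ^ (-(3999 / 3996000 : ℝ)) ≤ X ^ (-(1 / 1000 : ℝ)) :=
        Real.rpow_le_rpow_of_exponent_le hX1 (by norm_num)
      have h5 : 0 ≤ X ^ (-(3999 / 3996000 : ℝ)) := Real.rpow_nonneg hX0.le _
      have h6 : x ^ (-(1 / 999 : ℝ)) ≤ X ^ (-(1 / 1000 : ℝ)) * 2 := by
        rw [h2] at h1
        exact h1.trans (mul_le_mul h4 h3 (Real.rpow_nonneg two_pos.le _) (Real.rpow_nonneg hX0.le _))
      linarith only [h6]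
    have hδup : δ ≤ x ^ (-(1 / 1000 : ℝ)) := by
      rw [hδ_def]
      have h1 : X ^ (-(1 / 1000 : ℝ)) ≤ x ^ (-(1 / 1000 : ℝ)) :=
        Real.rpow_le_rpow_of_nonpos hx0 (hxX.trans (half_le_self hX0.le)) (by norm_num)
      have h2 : 0 ≤ X ^ (-(1 / 1000 : ℝ)) := Real.rpow_nonneg hX0.le _
      linarith only [h1, h2]
    -- (x4) the range of `h` (a fixed bound, independent of the scale)
    have hhx : (h : ℝ) ≤ A := hhAc
    -- (x5) the logarithms
    have hlogx_up : Real.log x ≤ Real.log X := Real.log_le_log hx0 (hxX.trans (half_le_self hX0.le))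
    have hlogx_low : 0.89 * Real.log X ≤ Real.log x := by
      have h1 : Real.log (X ^ (3999 / 4000 : ℝ) / 2) ≤ Real.log x := Real.log_le_log (by positivity) hxlow
      rw [Real.log_div hX399.ne' two_ne_zero, Real.log_rpow hX0] at h1
      linarith only [h1, hlogXge, hlogX0]
    -- (x6) smoothing the block
    have hsmooth : |(∑ n ∈ Ioc ⌊x⌋₊ ⌊2 * x⌋₊, a n) - ∑ n ∈ Icc 1 ⌊2 * x⌋₊, g (n / x) * a n| ≤
        (2 * δ * x + 2) * L ^ 2 :=
      abs_sum_Ioc_sub_sum_smooth_le hx1 hδ0 hδhalf ha0 fun n hn => by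
        obtain ⟨hn1, hn2⟩ := Finset.mem_Icc.mp hn
        refine haL n hn1 (le_trans ?_ (show 2 * x ≤ 2 * X by linarith only [hxX, hX0]))
        exact le_trans (by exact_mod_cast hn2) (Nat.floor_le (by positivity))
    -- (x7) the hypothesis on the block
    have hHx := H' q hq3 χ hprim hquad η hη hL x hq8 δ hδlow hδup hδhalf h hh hhx
    have hEx : Real.exp (-(2 * C) * Real.sqrt (Real.log x / Real.log q * Real.log η)) + Rh x +
        Real.log x / Real.log q * ρ η ≤ E := by
      have h13 := errorTerms13_dyadic_le₃ hC (hρ η hη) hlogX0 hlogx_low hlogx_up hlogq hη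
      have h2 := hR x X hX1024 hlogx_low hlogx_up
      rw [hE_def, hVeq]
      linarith
    have hmain : |(∑ n ∈ Icc 1 ⌊2 * x⌋₊, g (n / x) * a n) - x * I * 𝔖 * (1 + corr)| ≤ K' * hφ * x * E := by
      refine hHx.trans ?_
      exact mul_le_mul_of_nonneg_left hEx (by positivity)
    -- combine
    rw [show ⌊X / 2 ^ j⌋₊ = ⌊2 * x⌋₊ by rw [hx2]]
    calc |(∑ n ∈ Ioc ⌊x⌋₊ ⌊2 * x⌋₊, a n) - x * I * 𝔖 * (1 + corr)|
        ≤ |(∑ n ∈ Ioc ⌊x⌋₊ ⌊2 * x⌋₊, a n) - ∑ n ∈ Icc 1 ⌊2 * x⌋₊, g (n / x) * a n| +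
            |(∑ n ∈ Icc 1 ⌊2 * x⌋₊, g (n / x) * a n) - x * I * 𝔖 * (1 + corr)| := abs_sub_le _ _ _
      _ ≤ (2 * δ * x + 2) * L ^ 2 + K' * hφ * x * E := add_le_add hsmooth hmain
  -- summing the blocks
  have hsumx : ∑ j ∈ Finset.range J, X / 2 ^ (j + 1) = X - X / 2 ^ J := sum_dyadic_scales X J
  have hXJ0 : 0 ≤ X / 2 ^ J := by positivity
  have hblocks : |(∑ j ∈ Finset.range J, ∑ n ∈ Ioc ⌊X / 2 ^ (j + 1)⌋₊ ⌊X / 2 ^ j⌋₊, a n) -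
      (X - X / 2 ^ J) * I * 𝔖 * (1 + corr)| ≤ (2 * δ * X + 2 * J) * L ^ 2 + K' * hφ * X * E := by
    have hrew : (X - X / 2 ^ J) * I * 𝔖 * (1 + corr) =
        ∑ j ∈ Finset.range J, X / 2 ^ (j + 1) * I * 𝔖 * (1 + corr) := by
      rw [← hsumx, Finset.sum_mul, Finset.sum_mul, Finset.sum_mul]
    rw [hrew, ← Finset.sum_sub_distrib]
    refine (Finset.abs_sum_le_sum_abs _ _).trans ?_
    refine (Finset.sum_le_sum hblock).trans ?_
    rw [Finset.sum_add_distrib]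
    have h1 : ∑ j ∈ Finset.range J, (2 * δ * (X / 2 ^ (j + 1)) + 2) * L ^ 2 =
        (2 * δ * (X - X / 2 ^ J) + 2 * J) * L ^ 2 := by
      rw [← Finset.sum_mul, Finset.sum_add_distrib, ← Finset.mul_sum, hsumx, Finset.sum_const,
        Finset.card_range, nsmul_eq_mul]
      ring
    have h2 : ∑ j ∈ Finset.range J, K' * hφ * (X / 2 ^ (j + 1)) * E = K' * hφ * (X - X / 2 ^ J) * E := by
      rw [← hsumx, Finset.mul_sum, Finset.sum_mul]
    rw [h1, h2]
    have h3 : 0 ≤ K' * hφ * E := by positivity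
    have h4 : 0 ≤ 2 * δ * L ^ 2 := by positivity
    have h5 : (2 * δ * (X - X / 2 ^ J) + 2 * J) * L ^ 2 ≤ (2 * δ * X + 2 * J) * L ^ 2 := by
      refine mul_le_mul_of_nonneg_right ?_ (by positivity)
      have : 0 ≤ 2 * δ * (X / 2 ^ J) := by positivity
      linarith only [this]
    have h6 : K' * hφ * (X - X / 2 ^ J) * E ≤ K' * hφ * X * E := by
      refine mul_le_mul_of_nonneg_right (mul_le_mul_of_nonneg_left ?_ (by positivity)) hE0
      linarith only [hXJ0]
    exact add_le_add h5 h6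
  -- the initial segment
  have hinit : |∑ n ∈ Icc 1 ⌊X / 2 ^ J⌋₊, a n| ≤ X ^ (3999 / 4000 : ℝ) * L ^ 2 := by
    rw [abs_of_nonneg (Finset.sum_nonneg fun n _ => ha0 n)]
    calc ∑ n ∈ Icc 1 ⌊X / 2 ^ J⌋₊, a n ≤ ∑ n ∈ Icc 1 ⌊X / 2 ^ J⌋₊, L ^ 2 := by
          refine Finset.sum_le_sum fun n hn => ?_
          obtain ⟨hn1, hn2⟩ := Finset.mem_Icc.mp hn
          refine haL n hn1 (le_trans (le_trans (by exact_mod_cast hn2) (Nat.floor_le hXJ0)) ?_)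
          have : X / 2 ^ J ≤ X := div_le_self hX0.le (one_le_pow₀ one_le_two)
          linarith only [this, hX0]
      _ = (⌊X / 2 ^ J⌋₊ : ℝ) * L ^ 2 := by rw [Finset.sum_const, Nat.card_Icc, nsmul_eq_mul]; simp
      _ ≤ X ^ (3999 / 4000 : ℝ) * L ^ 2 := by
          refine mul_le_mul_of_nonneg_right ((Nat.floor_le hXJ0).trans hXJ.le) (by positivity)
  -- the main terms
  have hmainterm : |(X - X / 2 ^ J) * I * 𝔖 * (1 + corr) - X * 𝔖 * (1 + corr)| ≤
      12 * hφ * (X ^ (999 / 1000 : ℝ) + X ^ (3999 / 4000 : ℝ)) := by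
    have e : (X - X / 2 ^ J) * I * 𝔖 * (1 + corr) - X * 𝔖 * (1 + corr) =
        -((X * (1 - I) + X / 2 ^ J * I) * (𝔖 * (1 + corr))) := by ring
    rw [e, abs_neg, abs_mul, abs_mul]
    have h1 : |X * (1 - I) + X / 2 ^ J * I| ≤ X ^ (999 / 1000 : ℝ) + X ^ (3999 / 4000 : ℝ) := by
      have hI3 : 0 ≤ X * (1 - I) := mul_nonneg hX0.le (by linarith only [hI1])
      have hI4 : 0 ≤ X / 2 ^ J * I := mul_nonneg hXJ0 hI0
      rw [abs_of_nonneg (by linarith only [hI3, hI4])]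
      have hI5 : X * (1 - I) ≤ 2 * δ * X := by
        have := mul_le_mul_of_nonneg_left (show 1 - I ≤ 2 * δ by linarith only [hI2]) hX0.le
        linarith only [this]
      have hI6 : X / 2 ^ J * I ≤ X / 2 ^ J := mul_le_of_le_one_right hXJ0 hI1
      linarith only [hI5, hI6, hδX, hXJ]
    have h2 : |𝔖| * |1 + corr| ≤ 6 * hφ * 2 := by
      rw [abs_of_nonneg h𝔖0]
      exact mul_le_mul h𝔖le hcorr1 (abs_nonneg _) (by positivity)
    have h3 : 0 ≤ |𝔖| * |1 + corr| := by positivity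
    calc |X * (1 - I) + X / 2 ^ J * I| * (|𝔖| * |1 + corr|)
        ≤ (X ^ (999 / 1000 : ℝ) + X ^ (3999 / 4000 : ℝ)) * (6 * hφ * 2) :=
          mul_le_mul h1 h2 h3 (by positivity)
      _ = 12 * hφ * (X ^ (999 / 1000 : ℝ) + X ^ (3999 / 4000 : ℝ)) := by ring
  -- the polynomially small errors
  have hX99 : X ^ (999 / 1000 : ℝ) ≤ X ^ (3999 / 4000 : ℝ) := Real.rpow_le_rpow_of_exponent_le hX1 (by norm_num)
  have hX399_1 : 1 ≤ X ^ (3999 / 4000 : ℝ) := Real.one_le_rpow hX1 (by norm_num)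
  have hL3 : L ^ 3 ≤ 24000 ^ 3 * (3 + A) * X ^ (1 / 8000 : ℝ) := by
    have h1 := log_pow_three_le_rpow (show (0 : ℝ) < 1 / 8000 by norm_num) (show (1 : ℝ) ≤ (3 + A) * X by linarith)
    rw [← hL_def, Real.mul_rpow (by linarith) hX0.le] at h1
    have h2 : (3 + A) ^ (1 / 8000 : ℝ) ≤ 3 + A := by
      conv_rhs => rw [← Real.rpow_one (3 + A)]
      exact Real.rpow_le_rpow_of_exponent_le (by linarith) (by norm_num)
    have h3 : 0 ≤ X ^ (1 / 8000 : ℝ) := Real.rpow_nonneg hX0.le _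
    calc L ^ 3 ≤ (3 / (1 / 8000)) ^ 3 * ((3 + A) ^ (1 / 8000 : ℝ) * X ^ (1 / 8000 : ℝ)) := h1
      _ = 24000 ^ 3 * ((3 + A) ^ (1 / 8000 : ℝ) * X ^ (1 / 8000 : ℝ)) := by norm_num
      _ ≤ 24000 ^ 3 * ((3 + A) * X ^ (1 / 8000 : ℝ)) := by gcongr
      _ = 24000 ^ 3 * (3 + A) * X ^ (1 / 8000 : ℝ) := by ring
  have hstuff : X ^ (3999 / 4000 : ℝ) * L ^ 2 + (2 * δ * X + 2 * J) * L ^ 2 +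
      12 * hφ * (X ^ (999 / 1000 : ℝ) + X ^ (3999 / 4000 : ℝ)) ≤ KA * hφ * X * X ^ (-(1 / 8000 : ℝ)) := by
    rw [hδX]
    have hpoly := poly_errors_le hX399_1 hX99 hL1 hhφ1 hJL
    have hX' : X ^ (3999 / 4000 : ℝ) * X ^ (1 / 8000 : ℝ) = X * X ^ (-(1 / 8000 : ℝ)) := by
      rw [← Real.rpow_add hX0, show (3999 / 4000 : ℝ) + 1 / 8000 = 1 + -(1 / 8000) by norm_num,
        Real.rpow_add hX0, Real.rpow_one]
    have h4 : 30 * hφ * L ^ 3 * X ^ (3999 / 4000 : ℝ) ≤ KA * hφ * X * X ^ (-(1 / 8000 : ℝ)) := by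
      have hφ0 : 0 ≤ hφ := by linarith only [hhφ1]
      calc 30 * hφ * L ^ 3 * X ^ (3999 / 4000 : ℝ)
          ≤ 30 * hφ * (24000 ^ 3 * (3 + A) * X ^ (1 / 8000 : ℝ)) * X ^ (3999 / 4000 : ℝ) :=
            mul_le_mul_of_nonneg_right (mul_le_mul_of_nonneg_left hL3 (by positivity))
              (Real.rpow_nonneg hX0.le _)
        _ = KA * hφ * (X ^ (3999 / 4000 : ℝ) * X ^ (1 / 8000 : ℝ)) := by rw [hKA]; ring
        _ = KA * hφ * X * X ^ (-(1 / 8000 : ℝ)) := by rw [hX']; ring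
    exact hpoly.trans h4
  have habsorb : KA * hφ * X * X ^ (-(1 / 8000 : ℝ)) ≤ KA * Kabs * hφ * X * E := by
    have h1 := Habs X hX3
    calc KA * hφ * X * X ^ (-(1 / 8000 : ℝ)) ≤ KA * hφ * X * (Kabs * Rc X) :=
          mul_le_mul_of_nonneg_left h1 (by positivity)
      _ ≤ KA * hφ * X * (Kabs * E) := by gcongr
      _ = KA * Kabs * hφ * X * E := by ring
  -- assemble
  rw [sum_Icc_eq_sum_add_sum_dyadic a hX0.le J]
  have e : (∑ n ∈ Icc 1 ⌊X / 2 ^ J⌋₊, a n) +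
      (∑ j ∈ Finset.range J, ∑ n ∈ Ioc ⌊X / 2 ^ (j + 1)⌋₊ ⌊X / 2 ^ j⌋₊, a n) - X * 𝔖 * (1 + corr) =
      (∑ n ∈ Icc 1 ⌊X / 2 ^ J⌋₊, a n) +
      ((∑ j ∈ Finset.range J, ∑ n ∈ Ioc ⌊X / 2 ^ (j + 1)⌋₊ ⌊X / 2 ^ j⌋₊, a n) -
        (X - X / 2 ^ J) * I * 𝔖 * (1 + corr)) +
      ((X - X / 2 ^ J) * I * 𝔖 * (1 + corr) - X * 𝔖 * (1 + corr)) := by ring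
  rw [e]
  calc |(∑ n ∈ Icc 1 ⌊X / 2 ^ J⌋₊, a n) +
        ((∑ j ∈ Finset.range J, ∑ n ∈ Ioc ⌊X / 2 ^ (j + 1)⌋₊ ⌊X / 2 ^ j⌋₊, a n) -
          (X - X / 2 ^ J) * I * 𝔖 * (1 + corr)) +
        ((X - X / 2 ^ J) * I * 𝔖 * (1 + corr) - X * 𝔖 * (1 + corr))|
      ≤ |∑ n ∈ Icc 1 ⌊X / 2 ^ J⌋₊, a n| +
        |(∑ j ∈ Finset.range J, ∑ n ∈ Ioc ⌊X / 2 ^ (j + 1)⌋₊ ⌊X / 2 ^ j⌋₊, a n) -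
          (X - X / 2 ^ J) * I * 𝔖 * (1 + corr)| +
        |(X - X / 2 ^ J) * I * 𝔖 * (1 + corr) - X * 𝔖 * (1 + corr)| := abs_add_three _ _ _
    _ ≤ X ^ (3999 / 4000 : ℝ) * L ^ 2 + ((2 * δ * X + 2 * J) * L ^ 2 + K' * hφ * X * E) +
        12 * hφ * (X ^ (999 / 1000 : ℝ) + X ^ (3999 / 4000 : ℝ)) := add_le_add (add_le_add hinit hblocks) hmainterm
    _ ≤ K' * hφ * X * E + KA * Kabs * hφ * X * E := by linarith [hstuff, habsorb]
    _ = (K' + KA * Kabs) * ((h : ℝ) / (Nat.totient h : ℝ)) * X *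
        (Real.exp (-C * Real.sqrt (V * Real.log η)) + Rc X + V * ρ η) := by rw [hhφ, hE_def]; ring


set_option maxHeartbeats 800000 in
/-- **The degenerate regimes (general second and third rates) for shifts bounded by a CONSTANT.**
As `MMSmoothing.smoothed_of_core_generic₃` (proof verbatim), with the range `1 ≤ h ≤ A x^{1+1/3999}` replaced
by `1 ≤ h ≤ A` in hypothesis and conclusion. [cite: MatomakiMerikoski2023, §7 first paragraph] -/
theorem smoothed_smallShift_of_core_generic₃ {C A : ℝ} (hA : 0 < A) {ρ : ℝ → ℝ} (hρ : ∀ η : ℝ, 10 ≤ η → 0 ≤ ρ η)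
    {cρ : ℝ} (hcρ : 0 < cρ) (hρlow : ∀ η : ℝ, 10 ≤ η → cρ / η ≤ ρ η) {R : ℝ → ℝ}
    (hR0 : ∀ x : ℝ, 3 ≤ x → 0 ≤ R x) {Ke : ℝ} (hKe : 0 < Ke)
    (He : ∀ x : ℝ, 3 ≤ x → x ^ (-(1 / 1000 : ℝ)) ≤ Ke * R x) {η₀ K₁ : ℝ} (hK₁ : 0 < K₁)
    (H₁ : ∀ (q : ℕ) [NeZero q], 3 ≤ q → ∀ χ : DirichletCharacter ℂ q, χ.IsPrimitive → χ.IsQuadratic →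
        ∀ η : ℝ, 10 ≤ η → η₀ ≤ η → χ.LFunction ((1 - 1 / (η * Real.log q) : ℝ) : ℂ) = 0 →
          ∀ x : ℝ, (q : ℝ) ^ (37 / 4 : ℝ) ≤ x → Real.log x / Real.log q * ρ η ≤ 1 →
            ∀ δ : ℝ, x ^ (-(1 / 999 : ℝ)) / 4 ≤ δ → δ ≤ x ^ (-(1 / 1000 : ℝ)) → δ ≤ 1 / 2 →
            ∀ h : ℕ, 1 ≤ h → Even h → (h : ℝ) ≤ A →
              |(∑ n ∈ Icc 1 ⌊2 * x⌋₊,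
                  plateauCutoff (1 + δ) (2 - δ) δ (n / x) * (Λ n * Λ (n + h))) -
                  x * (∫ u, plateauCutoff (1 + δ) (2 - δ) δ u) * goldbachSingularSeries h *
                    (1 + if Nat.totient (2 ^ padicValNat 2 q) ∣ h then
                          (-1 : ℝ) ^ (h / Nat.totient (2 ^ padicValNat 2 q)) *
                            ∏ p ∈ (q / 2 ^ padicValNat 2 q).primeFactors.filter (fun p => ¬ p ∣ h),
                              (-1 : ℝ) / ((p : ℝ) - 2)
                        else 0)| ≤
                K₁ * ((h : ℝ) / (Nat.totient h : ℝ)) * x *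
                  (Real.exp (-C * Real.sqrt (Real.log x / Real.log q * Real.log η)) +
                    R x + Real.log x / Real.log q * ρ η)) :
    ∃ K : ℝ, 0 < K ∧
      ∀ (q : ℕ) [NeZero q], 3 ≤ q → ∀ χ : DirichletCharacter ℂ q, χ.IsPrimitive → χ.IsQuadratic →
        ∀ η : ℝ, 10 ≤ η → χ.LFunction ((1 - 1 / (η * Real.log q) : ℝ) : ℂ) = 0 →
          ∀ x : ℝ, (q : ℝ) ^ (37 / 4 : ℝ) ≤ x →
            ∀ δ : ℝ, x ^ (-(1 / 999 : ℝ)) / 4 ≤ δ → δ ≤ x ^ (-(1 / 1000 : ℝ)) → δ ≤ 1 / 2 →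
            ∀ h : ℕ, 1 ≤ h → (h : ℝ) ≤ A →
              |(∑ n ∈ Icc 1 ⌊2 * x⌋₊,
                  plateauCutoff (1 + δ) (2 - δ) δ (n / x) * (Λ n * Λ (n + h))) -
                  x * (∫ u, plateauCutoff (1 + δ) (2 - δ) δ u) * goldbachSingularSeries h *
                    (1 + if Nat.totient (2 ^ padicValNat 2 q) ∣ h then
                          (-1 : ℝ) ^ (h / Nat.totient (2 ^ padicValNat 2 q)) *
                            ∏ p ∈ (q / 2 ^ padicValNat 2 q).primeFactors.filter (fun p => ¬ p ∣ h),
                              (-1 : ℝ) / ((p : ℝ) - 2)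
                        else 0)| ≤
                K * ((h : ℝ) / (Nat.totient h : ℝ)) * x *
                  (Real.exp (-C * Real.sqrt (Real.log x / Real.log q * Real.log η)) +
                    R x + Real.log x / Real.log q * ρ η) := by
  obtain ⟨CB, hCB, HB⟩ := sum_vonMangoldt_mul_shift_le
  -- constants
  set η₁ : ℝ := max η₀ 10 with hη₁
  have hη₁0 : 0 < η₁ := lt_of_lt_of_le (by norm_num) (le_max_right _ _)
  set c₀ : ℝ := min 1 (8 * cρ / η₁) with hc₀
  have hc₀0 : 0 < c₀ := lt_min one_pos (by positivity)
  have hc₀1 : c₀ ≤ 1 := min_le_left _ _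
  set LA : ℝ := Real.log (2 + A) + 1.06 * Real.log A with hLA
  set aA : ℝ := Real.log (2 + A) + 1.01 with haA
  have haA1 : 1 ≤ aA := by
    have : 0 ≤ Real.log (2 + A) := Real.log_nonneg (by linarith)
    rw [haA]; linarith
  set KT : ℝ := (2 * CB + 2 * LA ^ 2 + 12) / c₀ with hKT
  have hKT0 : 0 < KT := by positivity
  set KO : ℝ := 8748 * aA ^ 2 * Ke with hKO
  have hKO0 : 0 < KO := by positivity
  refine ⟨K₁ + KT + KO, by positivity, ?_⟩
  intro q _ hq χ hprim hquad η hη hL x hx δ hδ hδup hδ2 h hh hhAc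
  -- basic facts
  have hq2 : (3 : ℝ) ≤ q := by exact_mod_cast hq
  have hq8 : (256 : ℝ) ≤ (q : ℝ) ^ (37 / 4 : ℝ) := by
    have h9 : (3 : ℝ) ^ (9 : ℕ) = (3 : ℝ) ^ (9 : ℝ) := by exact_mod_cast (Real.rpow_natCast (3 : ℝ) 9).symm
    calc (256 : ℝ) ≤ (3 : ℝ) ^ (9 : ℕ) := by norm_num
      _ = (3 : ℝ) ^ (9 : ℝ) := h9
      _ ≤ (3 : ℝ) ^ (37 / 4 : ℝ) := Real.rpow_le_rpow_of_exponent_le (by norm_num) (by norm_num)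
      _ ≤ (q : ℝ) ^ (37 / 4 : ℝ) := Real.rpow_le_rpow (by norm_num) hq2 (by norm_num)
  have hx256 : (256 : ℝ) ≤ x := hq8.trans hx
  have hx1 : (1 : ℝ) ≤ x := by linarith
  have hx0 : 0 < x := by linarith
  have hhA : (h : ℝ) ≤ A * x ^ (1 + 1 / 3999 : ℝ) :=
    hhAc.trans (le_mul_of_one_le_right hA.le (Real.one_le_rpow hx1 (by norm_num)))
  have hlogq : 0 < Real.log q := Real.log_pos (by linarith)
  have hlogx : Real.log 256 ≤ Real.log x := Real.log_le_log (by norm_num) hx256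
  have hlog256 : (5.5 : ℝ) ≤ Real.log 256 := by
    rw [show (256 : ℝ) = 2 ^ 8 by norm_num, Real.log_pow]
    have := Real.log_two_gt_d9
    push_cast; linarith only [this]
  have hlogx5 : (5.5 : ℝ) ≤ Real.log x := hlog256.trans hlogx
  have hlogx0 : 0 < Real.log x := by linarith
  have hη0 : 0 < η := by linarith
  have hlogη : 2 ≤ Real.log η := by
    have hlog10 : (2 : ℝ) < Real.log 10 := by
      rw [Real.lt_log_iff_exp_lt (by norm_num)]
      have h1 : Real.exp 1 < 2.7182818286 := Real.exp_one_lt_d9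
      have h2 : Real.exp 2 = Real.exp 1 * Real.exp 1 := by rw [← Real.exp_add]; norm_num
      rw [h2]; nlinarith [Real.exp_pos 1]
    have := Real.log_le_log (by norm_num) hη
    linarith
  have hV0 : 0 ≤ Real.log x / Real.log q := div_nonneg hlogx0.le hlogq.le
  have hterm0 : 0 ≤ Real.log x / Real.log q * ρ η := mul_nonneg hV0 (hρ η hη)
  have hV' : 8 ≤ Real.log x / Real.log q := by
    rw [le_div_iff₀ hlogq]
    have : Real.log ((q : ℝ) ^ (37 / 4 : ℝ)) ≤ Real.log x := Real.log_le_log (by positivity) hx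
    rw [Real.log_rpow (by linarith)] at this
    nlinarith only [this, hlogq]
  -- the error factor
  set E : ℝ := Real.exp (-C * Real.sqrt (Real.log x / Real.log q * Real.log η)) + R x +
      Real.log x / Real.log q * ρ η with hE
  have hRx : 0 ≤ R x := hR0 x (by linarith)
  have hE3 : Real.log x / Real.log q * ρ η ≤ E := by
    rw [hE]; linarith [Real.exp_pos (-C * Real.sqrt (Real.log x / Real.log q * Real.log η)), hRx]
  have hE2 : R x ≤ E := by
    rw [hE]
    linarith only [Real.exp_pos (-C * Real.sqrt (Real.log x / Real.log q * Real.log η)), hterm0]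
  have hE1 : Real.exp (-C * Real.sqrt (Real.log x / Real.log q * Real.log η)) ≤ E := by
    rw [hE]; linarith only [hRx, hterm0]
  have hE0 : 0 < E := lt_of_lt_of_le (Real.exp_pos _) hE1
  have hEη : 8 * cρ / η ≤ E := by
    refine le_trans ?_ hE3
    have h1 := hρlow η hη
    have h2 : 0 ≤ ρ η := hρ η hη
    calc 8 * cρ / η = 8 * (cρ / η) := by ring
      _ ≤ 8 * ρ η := by gcongr
      _ ≤ Real.log x / Real.log q * ρ η := mul_le_mul_of_nonneg_right hV' h2
  -- the weight, the harmless factors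
  have hδ0 : 0 < δ := by
    have : 0 < x ^ (-(1 / 999 : ℝ)) / 4 := by positivity
    linarith
  set g : ℝ → ℝ := plateauCutoff (1 + δ) (2 - δ) δ with hg
  obtain ⟨hI0, hI1⟩ := integral_plateauCutoff_mem hδ0 hδ2
  set corr : ℝ := (if Nat.totient (2 ^ padicValNat 2 q) ∣ h then
      (-1 : ℝ) ^ (h / Nat.totient (2 ^ padicValNat 2 q)) *
        ∏ p ∈ (q / 2 ^ padicValNat 2 q).primeFactors.filter (fun p => ¬ p ∣ h),
          (-1 : ℝ) / ((p : ℝ) - 2)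
      else 0) with hcorr_def
  have hcorr1 : |1 + corr| ≤ 2 := by
    have h1 := abs_corr_le_one q h
    have := abs_add_le (1 : ℝ) corr; rw [abs_one] at this; linarith
  set w : ℝ := (h : ℝ) / (Nat.totient h : ℝ) with hw
  have hh0 : h ≠ 0 := by omega
  have hφ0 : (0 : ℝ) < Nat.totient h := by exact_mod_cast Nat.totient_pos.mpr (by omega)
  have hw1 : 1 ≤ w := by rw [hw, le_div_iff₀ hφ0, one_mul]; exact_mod_cast Nat.totient_le h
  have hS6 : goldbachSingularSeries h ≤ 6 * w := goldbachSingularSeries_le_mul_div_totient hh0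
  have hS0 : 0 ≤ goldbachSingularSeries h :=
    Literature.NumberTheory.Sieve.SingularSeriesMean.goldbachSingularSeries_nonneg h
  -- the main term is `≤ 12 w x` in modulus
  have hmain : |x * (∫ u, g u) * goldbachSingularSeries h * (1 + corr)| ≤ 12 * w * x := by
    rw [abs_mul, abs_mul, abs_mul, abs_of_pos hx0, abs_of_nonneg hI0, abs_of_nonneg hS0]
    calc x * (∫ u, g u) * goldbachSingularSeries h * |1 + corr|
        ≤ x * 1 * (6 * w) * 2 := by gcongr
      _ = 12 * w * x := by ring
  -- the integer range
  set N : ℕ := ⌊2 * x⌋₊ with hN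
  have hN2x : (N : ℝ) ≤ 2 * x := Nat.floor_le (by linarith)
  have hxN : x ≤ N := by
    have := Nat.lt_floor_add_one (2 * x); rw [← hN] at this; linarith
  have hN2 : 2 ≤ N := by
    rw [hN]; exact Nat.le_floor (by push_cast; linarith)
  have hN0 : (0 : ℝ) < N := by exact_mod_cast (show 0 < N by omega)
  have hsmooth := abs_sum_smooth_le (x := x) hδ0 hδ2 h
  -- `N + h ≤ (2 + A) x^{1.01}`
  have hx101 : x ≤ x ^ (1 + 1 / 3999 : ℝ) := by
    calc x = x ^ (1 : ℝ) := (Real.rpow_one x).symm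
      _ ≤ x ^ (1 + 1 / 3999 : ℝ) := Real.rpow_le_rpow_of_exponent_le hx1 (by norm_num)
  have hNh : (N : ℝ) + h ≤ (2 + A) * x ^ (1 + 1 / 3999 : ℝ) := by
    have : (2 + A) * x ^ (1 + 1 / 3999 : ℝ) = 2 * x ^ (1 + 1 / 3999 : ℝ) + A * x ^ (1 + 1 / 3999 : ℝ) := by
      ring
    rw [this]; linarith only [hN2x, hx101, hhA]
  have hlogNh : Real.log ((N : ℝ) + h) ≤ Real.log (2 + A) + 1.01 * Real.log x := by
    have h0 : (0 : ℝ) < (N : ℝ) + h := by positivity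
    calc Real.log ((N : ℝ) + h) ≤ Real.log ((2 + A) * x ^ (1 + 1 / 3999 : ℝ)) := Real.log_le_log h0 hNh
      _ = Real.log (2 + A) + (1 + 1 / 3999) * Real.log x := by
          rw [Real.log_mul (by positivity) (by positivity), Real.log_rpow hx0]
      _ ≤ Real.log (2 + A) + 1.01 * Real.log x := by nlinarith only [hlogx0]
  have hlogNh' : Real.log ((N : ℝ) + h) ≤ aA * Real.log x := by
    have h2A : 0 ≤ Real.log (2 + A) := Real.log_nonneg (by linarith)
    have hm : 0 ≤ Real.log (2 + A) * (Real.log x - 1) := mul_nonneg h2A (by linarith only [hlogx5])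
    calc Real.log ((N : ℝ) + h) ≤ Real.log (2 + A) + 1.01 * Real.log x := hlogNh
      _ ≤ Real.log (2 + A) * Real.log x + 1.01 * Real.log x := by linarith only [hm]
      _ = aA * Real.log x := by rw [haA]; ring
  have hlogNh0 : 0 ≤ Real.log ((N : ℝ) + h) := Real.log_nonneg (by
    have : (2 : ℝ) ≤ N := by exact_mod_cast hN2
    have : (0 : ℝ) ≤ h := Nat.cast_nonneg h
    linarith)
  ------------------------------------------------------------------
  -- Regime T: the error factor is `≥ c₀`
  ------------------------------------------------------------------
  by_cases hT : c₀ ≤ E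
  · have hsumle : ∑ n ∈ Icc 1 N, Λ n * Λ (n + h) ≤ (2 * CB + 2 * LA ^ 2) * w * x := by
      by_cases hAx : A ≤ x ^ (3998 / 3999 : ℝ)
      · -- sieve bound: `h ≤ A x^{1+1/3999} ≤ x^{1−1/3999} x^{1+1/3999} = x² ≤ N²`
        have hhN2 : (h : ℝ) ≤ (N : ℝ) ^ 2 := by
          calc (h : ℝ) ≤ A * x ^ (1 + 1 / 3999 : ℝ) := hhA
            _ ≤ x ^ (3998 / 3999 : ℝ) * x ^ (1 + 1 / 3999 : ℝ) :=
                mul_le_mul_of_nonneg_right hAx (by positivity)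
            _ = x ^ 2 := by
                rw [← Real.rpow_add hx0, ← Real.rpow_natCast]; norm_num
            _ ≤ (N : ℝ) ^ 2 := pow_le_pow_left₀ hx0.le hxN 2
        have hhN2' : h ≤ N ^ 2 := by exact_mod_cast hhN2
        calc ∑ n ∈ Icc 1 N, Λ n * Λ (n + h) ≤ CB * ((h : ℝ) / Nat.totient h) * N := HB N h hN2 hh hhN2'
          _ ≤ CB * w * (2 * x) := by rw [← hw]; gcongr
          _ = 2 * CB * w * x := by ring
          _ ≤ (2 * CB + 2 * LA ^ 2) * w * x := by
              have : 0 ≤ 2 * LA ^ 2 * w * x := by positivity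
              linarith
      · -- `x^{1−1/3999} < A`: everything is bounded in terms of `A`
        push Not at hAx
        have hx99 : (1 : ℝ) ≤ x ^ (3998 / 3999 : ℝ) := Real.one_le_rpow hx1 (by norm_num)
        have hA1 : 1 < A := lt_of_le_of_lt hx99 hAx
        have hlogA : 3998 / 3999 * Real.log x < Real.log A := by
          have := Real.log_lt_log (by positivity) hAx
          rwa [Real.log_rpow hx0] at this
        have hlApos : 0 < Real.log A := Real.log_pos hA1
        have hlogxA : Real.log x ≤ 1.04 * Real.log A := by linarith only [hlogA, hlApos.le]
        have hLA' : Real.log ((N : ℝ) + h) ≤ LA := by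
          calc Real.log ((N : ℝ) + h) ≤ Real.log (2 + A) + 1.01 * Real.log x := hlogNh
            _ ≤ Real.log (2 + A) + 1.06 * Real.log A := by linarith only [hlogxA, hlApos.le]
            _ = LA := by rw [hLA]
        have hLA0 : 0 ≤ LA := hlogNh0.trans hLA'
        calc ∑ n ∈ Icc 1 N, Λ n * Λ (n + h) ≤ N * Real.log ((N : ℝ) + h) ^ 2 :=
              sum_vonMangoldt_mul_le_card_mul_log_sq N h
          _ ≤ (2 * x) * LA ^ 2 := by
              gcongr
          _ ≤ (2 * x) * LA ^ 2 * w := le_mul_of_one_le_right (by positivity) hw1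
          _ = 2 * LA ^ 2 * w * x := by ring
          _ ≤ (2 * CB + 2 * LA ^ 2) * w * x := by
              have : 0 ≤ 2 * CB * w * x := by positivity
              linarith
    have hKTc : (2 * CB + 2 * LA ^ 2 + 12) = KT * c₀ := by
      rw [hKT]; field_simp
    calc |(∑ n ∈ Icc 1 N, g (n / x) * (Λ n * Λ (n + h))) -
            x * (∫ u, g u) * goldbachSingularSeries h * (1 + corr)|
        ≤ |∑ n ∈ Icc 1 N, g (n / x) * (Λ n * Λ (n + h))| +
            |x * (∫ u, g u) * goldbachSingularSeries h * (1 + corr)| := abs_sub _ _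
      _ ≤ (2 * CB + 2 * LA ^ 2) * w * x + 12 * w * x := add_le_add (hsmooth.trans hsumle) hmain
      _ = KT * c₀ * w * x := by rw [← hKTc]; ring
      _ ≤ KT * E * w * x := by gcongr
      _ ≤ (K₁ + KT + KO) * w * x * E := by
          have h0 : 0 ≤ (K₁ + KO) * w * x * E := by positivity
          have e : (K₁ + KT + KO) * w * x * E = KT * E * w * x + (K₁ + KO) * w * x * E := by ring
          rw [e]; linarith only [h0]
  push Not at hT
  ------------------------------------------------------------------
  -- Regime O: odd `h`
  ------------------------------------------------------------------
  by_cases hodd : Odd h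
  · have hmain0 : x * (∫ u, g u) * goldbachSingularSeries h * (1 + corr) = 0 := by
      rw [goldbachSingularSeries_of_odd hodd]; ring
    -- `∑ ≤ 12 aA² log³ x`
    have hl2 : (0.6931471803 : ℝ) < Real.log 2 := Real.log_two_gt_d9
    have hNat : (Nat.log 2 (N + h) : ℝ) ≤ Real.log ((N : ℝ) + h) / Real.log 2 := by
      rw [le_div_iff₀ (by linarith), ← Real.log_pow]
      have : ((2 ^ Nat.log 2 (N + h) : ℕ) : ℝ) ≤ (N : ℝ) + h := by
        exact_mod_cast Nat.pow_log_le_self 2 (by omega)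
      push_cast at this
      exact Real.log_le_log (by positivity) this
    have hlogN : Real.log N ≤ 2 * Real.log x := by
      calc Real.log N ≤ Real.log (2 * x) := Real.log_le_log hN0 hN2x
        _ = Real.log 2 + Real.log x := Real.log_mul (by norm_num) hx0.ne'
        _ ≤ 2 * Real.log x := by
            have : Real.log 2 < 0.6931471808 := Real.log_two_lt_d9
            linarith
    have hlogN0 : 0 ≤ Real.log N := Real.log_nonneg (by exact_mod_cast (show 1 ≤ N by omega))
    have hodd_sum : ∑ n ∈ Icc 1 N, Λ n * Λ (n + h) ≤ 12 * aA ^ 2 * Real.log x ^ 3 := by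
      have h1 := sum_vonMangoldt_mul_shift_le_of_odd (N := N) hodd
      have hfac1 : 2 * ((Nat.log 2 (N + h) : ℝ) + 1) ≤ 6 * (aA * Real.log x) := by
        have h3 : (Nat.log 2 (N + h) : ℝ) ≤ 2 * (aA * Real.log x) := by
          calc (Nat.log 2 (N + h) : ℝ) ≤ Real.log ((N : ℝ) + h) / Real.log 2 := hNat
            _ ≤ (aA * Real.log x) / Real.log 2 := by gcongr
            _ ≤ 2 * (aA * Real.log x) := by
                rw [div_le_iff₀ (by linarith only [hl2])]
                have hpos : 0 ≤ aA * Real.log x := by positivity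
                have h22 : (1 : ℝ) ≤ 2 * Real.log 2 := by linarith only [hl2]
                nlinarith only [hpos, h22]
        have h4 : (1 : ℝ) ≤ aA * Real.log x :=
          one_le_mul_of_one_le_of_one_le haA1 (by linarith only [hlogx5])
        linarith only [h3, h4]
      calc ∑ n ∈ Icc 1 N, Λ n * Λ (n + h)
          ≤ 2 * ((Nat.log 2 (N + h) : ℝ) + 1) * (Real.log N * Real.log ((N : ℝ) + h)) := h1
        _ ≤ 6 * (aA * Real.log x) * (2 * Real.log x * (aA * Real.log x)) := by
            gcongr
        _ = 12 * aA ^ 2 * Real.log x ^ 3 := by ring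
    -- `log³ x ≤ 729 x^{1/3} ≤ 729 x · x^{-1/1000} ≤ 729 Ke x R(x)`
    have hL9 : Real.log x ≤ 9 * x ^ ((1 : ℝ) / 9) :=
      Literature.NumberTheory.Sieve.PrimePairsVonMangoldt.log_le_nine_mul_rpow hx0.le
    have hL3 : Real.log x ^ 3 ≤ 729 * (x * x ^ (-(1 / 1000 : ℝ))) := by
      calc Real.log x ^ 3 ≤ (9 * x ^ ((1 : ℝ) / 9)) ^ 3 := pow_le_pow_left₀ hlogx0.le hL9 3
        _ = 729 * x ^ ((1 : ℝ) / 3) := by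
            rw [mul_pow, ← Real.rpow_natCast (x ^ ((1 : ℝ) / 9)), ← Real.rpow_mul hx0.le]
            norm_num
        _ ≤ 729 * (x * x ^ (-(1 / 1000 : ℝ))) := by
            gcongr
            rw [show x * x ^ (-(1 / 1000 : ℝ)) = x ^ ((1 : ℝ) + -(1 / 1000 : ℝ)) by
              rw [Real.rpow_add hx0, Real.rpow_one]]
            exact Real.rpow_le_rpow_of_exponent_le hx1 (by norm_num)
    have hHe := He x (by linarith)
    calc |(∑ n ∈ Icc 1 N, g (n / x) * (Λ n * Λ (n + h))) -
            x * (∫ u, g u) * goldbachSingularSeries h * (1 + corr)|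
        = |∑ n ∈ Icc 1 N, g (n / x) * (Λ n * Λ (n + h))| := by rw [hmain0, sub_zero]
      _ ≤ 12 * aA ^ 2 * Real.log x ^ 3 := hsmooth.trans hodd_sum
      _ ≤ 12 * aA ^ 2 * (729 * (x * x ^ (-(1 / 1000 : ℝ)))) := by gcongr
      _ ≤ 12 * aA ^ 2 * (729 * (x * (Ke * R x))) := by gcongr
      _ = KO * x * R x := by rw [hKO]; ring
      _ ≤ KO * x * E := by gcongr
      _ ≤ (K₁ + KT + KO) * w * x * E := by
          have h1 : KO * x * E ≤ KO * x * E * w := le_mul_of_one_le_right (by positivity) hw1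
          have h2 : 0 ≤ (K₁ + KT) * w * x * E := by positivity
          have e : (K₁ + KT + KO) * w * x * E = KO * x * E * w + (K₁ + KT) * w * x * E := by ring
          rw [e]; linarith only [h1, h2]
  ------------------------------------------------------------------
  -- Core regime: `h` even, `η ≥ η₁ ≥ η₀`, normalised error
  ------------------------------------------------------------------
  have heven : Even h := Nat.not_odd_iff_even.mp hodd
  have hη₁η : η₁ ≤ η := by
    by_contra hlt
    push Not at hlt
    have : 8 * cρ / η₁ ≤ E := by
      calc 8 * cρ / η₁ ≤ 8 * cρ / η := div_le_div_of_nonneg_left (by positivity) hη0 hlt.le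
        _ ≤ E := hEη
    exact absurd ((min_le_right _ _).trans this) (not_le.mpr hT)
  have hη₀η : η₀ ≤ η := (le_max_left _ _).trans hη₁η
  have hnorm : Real.log x / Real.log q * ρ η ≤ 1 :=
    (hE3.trans hT.le).trans hc₀1
  have hcore := H₁ q hq χ hprim hquad η hη hη₀η hL x hx hnorm δ hδ hδup hδ2 h hh heven hhAc
  calc |(∑ n ∈ Icc 1 N, g (n / x) * (Λ n * Λ (n + h))) -
          x * (∫ u, g u) * goldbachSingularSeries h * (1 + corr)|
      ≤ K₁ * w * x * E := hcore
    _ ≤ (K₁ + KT + KO) * w * x * E := by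
        have h0 : 0 ≤ (KT + KO) * w * x * E := by positivity
        have e : (K₁ + KT + KO) * w * x * E = K₁ * w * x * E + (KT + KO) * w * x * E := by ring
        rw [e]; linarith only [h0]



end MMSmoothing

open MMSmoothing

set_option maxHeartbeats 800000 in
/-- **Corollary 1.1(i) from Theorem 1.3 restricted to shifts `h ≤ A` (classical second rate, general third
rate).** As `MatomakiMerikoski2023_fixedShift_of_weakPairCorrelation_generic` (proof verbatim), but the
hypothesis is only Theorem 1.3 for `1 ≤ h ≤ A` (constants depending on `C, A`); the deduction takes `A = h`.
[cite: MatomakiMerikoski2023, Corollary 1.1(i), Theorem 1.3 and the deduction after Theorem 1.4] -/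
theorem MatomakiMerikoski2023_fixedShift_of_weakPairCorrelation_smallShift {R : ℝ → ℝ}
    (hR0 : ∀ η : ℝ, 10 ≤ η → 0 ≤ R η)
    (hRdecay : ∀ C : ℝ, 1 ≤ C → ∃ K₃ : ℝ, 0 < K₃ ∧ ∀ η : ℝ, 10 ≤ η →
      10 * Real.log η * R η ≤ K₃ * Real.exp (-C * Real.sqrt (Real.log η)))
    {c₀ : ℝ} (hc₀ : 0 < c₀)
    (h13 : ∀ C : ℝ, 1 ≤ C → ∀ A : ℝ, 0 < A → ∃ K : ℝ, 0 < K ∧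
      ∀ (q : ℕ) [NeZero q], 2 ≤ q → ∀ χ : DirichletCharacter ℂ q, χ.IsPrimitive → χ.IsQuadratic →
        ∀ η : ℝ, 10 ≤ η → χ.LFunction ((1 - 1 / (η * Real.log q) : ℝ) : ℂ) = 0 →
          ∀ V X : ℝ, 10 ≤ V → X = (q : ℝ) ^ V → ∀ h : ℕ, 1 ≤ h → (h : ℝ) ≤ A →
            |(∑ n ∈ Icc 1 ⌊X⌋₊, Λ n * Λ (n + h)) -
                X * Literature.NumberTheory.Sieve.goldbachSingularSeries h *
                  (1 + if Nat.totient (2 ^ padicValNat 2 q) ∣ h then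
                        (-1 : ℝ) ^ (h / Nat.totient (2 ^ padicValNat 2 q)) *
                          ∏ p ∈ (q / 2 ^ padicValNat 2 q).primeFactors.filter (fun p => ¬ p ∣ h),
                            (-1 : ℝ) / ((p : ℝ) - 2)
                      else 0)| ≤
              K * ((h : ℝ) / (Nat.totient h : ℝ)) * X *
                (Real.exp (-C * Real.sqrt (V * Real.log η)) +
                  Real.exp (-c₀ * Real.sqrt (Real.log X)) +
                  V * R η)) :
    MatomakiMerikoski2023_fixedShift := by
  intro h hh C hC
  have hC0 : 0 < C := by linarith
  -- Siegel's theorem (MV Cor. 11.15) with exponent `ε = min(1/4, 10c₀²/C²)`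
  set ε : ℝ := min (1 / 4) (10 * c₀ ^ 2 / C ^ 2) with hεdef
  have hε : 0 < ε := lt_min (by norm_num) (by positivity)
  have hε4 : ε ≤ 1 / 4 := min_le_left _ _
  have hεC : C ^ 2 * ε ≤ 10 * c₀ ^ 2 := by
    have : ε ≤ 10 * c₀ ^ 2 / C ^ 2 := min_le_right _ _
    rwa [le_div_iff₀ (by positivity), mul_comm] at this
  obtain ⟨CS, hCS, hSiegel⟩ :=
    Literature.NumberTheory.LFunctions.Siegel.exists_one_sub_realZero_ge hε
  have hlog2 : 0 < Real.log 2 := Real.log_pos one_lt_two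
  set D : ℝ := 1 / (CS * Real.log 2) with hDdef
  have hD : 0 < D := by positivity
  -- Theorem 1.3 (classical form) with `C`, `A = h`
  have hh0 : (0 : ℝ) < h := by exact_mod_cast hh
  obtain ⟨K₁, hK₁, h13'⟩ := h13 C hC h hh0
  have htot : (0 : ℝ) < (Nat.totient h : ℝ) := by exact_mod_cast Nat.totient_pos.mpr hh
  set G : ℝ := Literature.NumberTheory.Sieve.goldbachSingularSeries h with hGdef
  -- the constants
  set B₀ : ℝ := Real.exp (C * Real.sqrt (|Real.log D|)) with hB₀def
  have hB₀1 : 1 ≤ B₀ := Real.one_le_exp (by positivity)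
  obtain ⟨K₃, hK₃0, hK₃⟩ := hRdecay C hC
  refine ⟨K₁ * ((h : ℝ) / (Nat.totient h : ℝ)) * (1 + B₀ + K₃) +
      |G| * Real.sqrt (24 * h) * (Real.exp ((C * Real.sqrt ε) ^ 2 / 2) * B₀), by positivity, ?_⟩
  intro q _ hq χ hprim hquad η hη hzero X hXlo hXhi
  -- basic positivity
  have hq2 : (2 : ℝ) ≤ q := by exact_mod_cast hq
  have hq1 : (1 : ℝ) ≤ q := by linarith
  have hq0 : (0 : ℝ) < q := by linarith
  have hlogq : Real.log 2 ≤ Real.log q := Real.log_le_log two_pos hq2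
  have hℓ0 : 0 < Real.log q := lt_of_lt_of_le hlog2 hlogq
  have hη0 : (0 : ℝ) < η := by linarith
  have hη1 : (1 : ℝ) ≤ η := by linarith
  set L : ℝ := Real.log η with hLdef
  have hL1 : 1 ≤ L := by
    rw [hLdef, Real.le_log_iff_exp_le hη0]
    linarith [Real.exp_one_lt_three]
  have hL0 : 0 < L := by linarith
  have hηL : Real.exp L = η := Real.exp_log hη0
  -- `X` and `V = log X / log q`
  have hq10 : (0 : ℝ) < (q : ℝ) ^ (10 : ℝ) := Real.rpow_pos_of_pos hq0 _
  have hX0 : 0 < X := lt_of_lt_of_le hq10 hXlo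
  have hX1 : 1 ≤ X := le_trans (Real.one_le_rpow hq1 (by norm_num)) hXlo
  set V : ℝ := Real.log X / Real.log q with hVdef
  have hlogX : Real.log X = V * Real.log q := by rw [hVdef]; field_simp
  have hX : X = (q : ℝ) ^ V := by
    rw [Real.rpow_def_of_pos hq0, mul_comm, ← hlogX, Real.exp_log hX0]
  have hlogXlo : 10 * Real.log q ≤ Real.log X := by
    have := Real.log_le_log hq10 hXlo
    rwa [Real.log_rpow hq0] at this
  have hlogXhi : Real.log X ≤ 10 * L * Real.log q := by
    have := Real.log_le_log hX0 hXhi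
    rwa [Real.log_rpow hq0] at this
  have hV10 : 10 ≤ V := by
    rw [hVdef, le_div_iff₀ hℓ0]; exact hlogXlo
  have hVhi : V ≤ 10 * L := by
    rw [hVdef, div_le_iff₀ hℓ0]; exact hlogXhi
  have hV0 : 0 < V := by linarith
  -- `χ ≠ 1`
  have hne : χ ≠ 1 := by
    intro h1
    have := (DirichletCharacter.eq_one_iff_conductor_eq_one (χ := χ)).mp h1
    rw [hprim] at this
    omega
  -- Siegel: `η ≤ D q^{ε}`, hence `L ≤ |log D| + ε log q`
  have hηD : η ≤ D * (q : ℝ) ^ ε := by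
    have hS := hSiegel q χ hquad.sq_eq_one hne (1 - 1 / (η * Real.log q)) hzero
    have hS' : CS * (q : ℝ) ^ (-ε) ≤ 1 / (η * Real.log q) := by linarith
    have hpos : 0 < CS * (q : ℝ) ^ (-ε) := by positivity
    have hηlog : η * Real.log q ≤ (q : ℝ) ^ ε / CS := by
      have := (le_one_div hpos (by positivity)).mp hS'
      calc η * Real.log q ≤ 1 / (CS * (q : ℝ) ^ (-ε)) := this
        _ = (q : ℝ) ^ ε / CS := by
            rw [Real.rpow_neg hq0.le]; field_simp
    calc η = η * Real.log q / Real.log q := by field_simp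
      _ ≤ ((q : ℝ) ^ ε / CS) / Real.log q := by gcongr
      _ ≤ ((q : ℝ) ^ ε / CS) / Real.log 2 := by gcongr
      _ = D * (q : ℝ) ^ ε := by rw [hDdef]; field_simp
  have hLle : L ≤ |Real.log D| + ε * Real.log q := by
    calc L ≤ Real.log (D * (q : ℝ) ^ ε) := Real.log_le_log hη0 hηD
      _ = Real.log D + ε * Real.log q := by
          rw [Real.log_mul hD.ne' (Real.rpow_pos_of_pos hq0 ε).ne', Real.log_rpow hq0]
      _ ≤ |Real.log D| + ε * Real.log q := by linarith [le_abs_self (Real.log D)]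
  -- the target rate `F = e^{-C√L}` and the floor `e^{-C√(εℓ)} ≤ B₀ F`
  set F : ℝ := Real.exp (-C * Real.sqrt L) with hFdef
  have hF0 : 0 < F := Real.exp_pos _
  have hfloor : Real.exp (-C * Real.sqrt (ε * Real.log q)) ≤ B₀ * F := by
    rw [hB₀def, hFdef, ← Real.exp_add, Real.exp_le_exp]
    have h1 : Real.sqrt L ≤ Real.sqrt (|Real.log D|) + Real.sqrt (ε * Real.log q) := by
      have ha : 0 ≤ |Real.log D| := abs_nonneg _
      have hb : 0 ≤ ε * Real.log q := by positivity
      calc Real.sqrt L ≤ Real.sqrt (|Real.log D| + ε * Real.log q) := Real.sqrt_le_sqrt hLle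
        _ ≤ Real.sqrt (|Real.log D|) + Real.sqrt (ε * Real.log q) := by
            rw [Real.sqrt_le_iff]
            refine ⟨by positivity, ?_⟩
            nlinarith [Real.sq_sqrt ha, Real.sq_sqrt hb, Real.sqrt_nonneg (|Real.log D|),
              Real.sqrt_nonneg (ε * Real.log q)]
    have h2 := mul_le_mul_of_nonneg_left h1 hC0.le
    linarith
  -- E1 = exp(−C√(V L)) ≤ F
  have hE1 : Real.exp (-C * Real.sqrt (V * L)) ≤ F :=
    MatomakiMerikoski.exp_neg_mul_sqrt_antitone hC0.le (le_mul_of_one_le_left hL0.le (by linarith))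
  -- E2 = exp(−c₀ √log X) ≤ exp(−c₀√(10 ℓ)) ≤ e^{−C√(εℓ)} ≤ B₀ F
  have hE2 : Real.exp (-c₀ * Real.sqrt (Real.log X)) ≤ B₀ * F := by
    refine le_trans ?_ hfloor
    rw [Real.exp_le_exp]
    -- `C √(εℓ) ≤ c₀ √(10 ℓ) ≤ c₀ √(log X)`
    have h1 : C * Real.sqrt (ε * Real.log q) ≤ c₀ * Real.sqrt (Real.log X) := by
      have hsq : (C * Real.sqrt (ε * Real.log q)) ^ 2 ≤ (c₀ * Real.sqrt (Real.log X)) ^ 2 := by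
        rw [mul_pow, mul_pow, Real.sq_sqrt (by positivity), Real.sq_sqrt (by linarith)]
        nlinarith [mul_le_mul_of_nonneg_right hεC hℓ0.le]
      have ha : 0 ≤ C * Real.sqrt (ε * Real.log q) := by positivity
      have hb : 0 ≤ c₀ * Real.sqrt (Real.log X) := by positivity
      exact (pow_le_pow_iff_left₀ ha hb two_ne_zero).mp hsq
    linarith
  -- E3 = V R(η) ≤ 10 L R(η) ≤ K₃ F
  have hE3 : V * R η ≤ K₃ * F := by
    have h3 := hK₃ η hη
    rw [← hLdef] at h3
    calc V * R η ≤ (10 * L) * R η := mul_le_mul_of_nonneg_right hVhi (hR0 η hη)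
      _ = 10 * L * R η := by ring
      _ ≤ K₃ * Real.exp (-C * Real.sqrt L) := h3
      _ = K₃ * F := by rw [hFdef]
  -- the correction factor: `|corr| ≤ √(24h/q) ≤ √(24h) e^{C²ε/2} B₀ F`
  have hcorr := SiegelCorr.abs_corr_le (R := ℂ) χ hprim hquad hh
  have hsqrtq : 1 / Real.sqrt q ≤ Real.exp ((C * Real.sqrt ε) ^ 2 / 2) * B₀ * F := by
    have hsq : Real.sqrt q = Real.exp (Real.log q / 2) := by
      rw [← Real.log_sqrt hq0.le, Real.exp_log (Real.sqrt_pos.mpr hq0)]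
    have hsqrtmul : Real.sqrt (ε * Real.log q) = Real.sqrt ε * Real.sqrt (Real.log q) :=
      Real.sqrt_mul hε.le _
    calc 1 / Real.sqrt q = Real.exp (-(Real.log q / 2)) := by
          rw [hsq, Real.exp_neg, one_div]
      _ ≤ Real.exp ((C * Real.sqrt ε) ^ 2 / 2) * Real.exp (-(C * Real.sqrt ε) * Real.sqrt (Real.log q)) :=
          MatomakiMerikoski.exp_neg_half_le (C * Real.sqrt ε) hℓ0.le
      _ = Real.exp ((C * Real.sqrt ε) ^ 2 / 2) * Real.exp (-C * Real.sqrt (ε * Real.log q)) := by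
          rw [hsqrtmul]; ring_nf
      _ ≤ Real.exp ((C * Real.sqrt ε) ^ 2 / 2) * (B₀ * F) := by gcongr
      _ = Real.exp ((C * Real.sqrt ε) ^ 2 / 2) * B₀ * F := by ring
  have hcorr' : Real.sqrt (24 * h / q) ≤
      Real.sqrt (24 * h) * (Real.exp ((C * Real.sqrt ε) ^ 2 / 2) * B₀) * F := by
    rw [Real.sqrt_div' _ hq0.le]
    calc Real.sqrt (24 * h) / Real.sqrt q = Real.sqrt (24 * h) * (1 / Real.sqrt q) := by ring
      _ ≤ Real.sqrt (24 * h) * (Real.exp ((C * Real.sqrt ε) ^ 2 / 2) * B₀ * F) := by gcongr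
      _ = Real.sqrt (24 * h) * (Real.exp ((C * Real.sqrt ε) ^ 2 / 2) * B₀) * F := by ring
  -- Theorem 1.3 (classical form)
  have hmain := h13' q hq χ hprim hquad η hη hzero V X hV10 hX h hh le_rfl
  -- assemble
  set S : ℝ := ∑ n ∈ Icc 1 ⌊X⌋₊, Λ n * Λ (n + h) with hSdef
  set corr : ℝ := (if Nat.totient (2 ^ padicValNat 2 q) ∣ h then
        (-1 : ℝ) ^ (h / Nat.totient (2 ^ padicValNat 2 q)) *
          ∏ p ∈ (q / 2 ^ padicValNat 2 q).primeFactors.filter (fun p => ¬ p ∣ h),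
            (-1 : ℝ) / ((p : ℝ) - 2)
      else 0) with hcorrdef
  have htri : |S - X * G| ≤ |S - X * G * (1 + corr)| + |X * G * (1 + corr) - X * G| :=
    abs_sub_le _ _ _
  have hmid : |X * G * (1 + corr) - X * G| = X * |G| * |corr| := by
    rw [show X * G * (1 + corr) - X * G = X * G * corr by ring, abs_mul, abs_mul, abs_of_pos hX0]
  have hsum : Real.exp (-C * Real.sqrt (V * L)) + Real.exp (-c₀ * Real.sqrt (Real.log X))
      + V * R η ≤ (1 + B₀ + K₃) * F := by
    linarith
  have hc0 : 0 ≤ K₁ * ((h : ℝ) / (Nat.totient h : ℝ)) * X := by positivity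
  calc |S - X * G| ≤ |S - X * G * (1 + corr)| + |X * G * (1 + corr) - X * G| := htri
    _ ≤ K₁ * ((h : ℝ) / (Nat.totient h : ℝ)) * X *
          (Real.exp (-C * Real.sqrt (V * L)) + Real.exp (-c₀ * Real.sqrt (Real.log X))
            + V * R η) + X * |G| * |corr| := by
        rw [hmid]; exact add_le_add hmain le_rfl
    _ ≤ K₁ * ((h : ℝ) / (Nat.totient h : ℝ)) * X * ((1 + B₀ + K₃) * F) +
          X * |G| * (Real.sqrt (24 * h) * (Real.exp ((C * Real.sqrt ε) ^ 2 / 2) * B₀) * F) := by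
        gcongr
        · exact hcorr.trans hcorr'
    _ = (K₁ * ((h : ℝ) / (Nat.totient h : ℝ)) * (1 + B₀ + K₃) +
          |G| * Real.sqrt (24 * h) * (Real.exp ((C * Real.sqrt ε) ^ 2 / 2) * B₀)) * X * F := by ring
    _ = _ := by rw [hFdef]

/-- **Theorem 1.3 for shifts `h ≤ A`, classical second rate, general third rate, from its smoothed dyadic
form for shifts `h ≤ A`.** Small-shift form of `MatomakiMerikoski2023_pairCorrelation_weak_of_smoothed₃`;
As `MatomakiMerikoski2023_pairCorrelation_classical_of_smoothed'` (same proof: the instance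
`R_h(x) = exp(−c₀√log x)`, `R_c(X) = exp(−(c₀/2)√log X)` of the dyadic smoothing reduction), with the
third rate `V' log⁶η/η` replaced by `V' ρ(η)` for any `ρ ≥ 0` on `[10, ∞)`
(`MMSmoothing.pairCorrelation_of_smoothed_generic₃`). [cite: MatomakiMerikoski2023, §2 and Theorem 1.3] -/
theorem MatomakiMerikoski2023_pairCorrelation_smallShift_of_smoothed₃ {ρ : ℝ → ℝ} (hρ : ∀ η : ℝ, 10 ≤ η → 0 ≤ ρ η)
    {c₀ : ℝ} (hc₀ : 0 < c₀)
    (H : ∀ C : ℝ, 1 ≤ C → ∀ A : ℝ, 0 < A → ∃ K : ℝ, 0 < K ∧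
      ∀ (q : ℕ) [NeZero q], 3 ≤ q → ∀ χ : DirichletCharacter ℂ q, χ.IsPrimitive → χ.IsQuadratic →
        ∀ η : ℝ, 10 ≤ η → χ.LFunction ((1 - 1 / (η * Real.log q) : ℝ) : ℂ) = 0 →
          ∀ x : ℝ, (q : ℝ) ^ (37 / 4 : ℝ) ≤ x →
            ∀ δ : ℝ, x ^ (-(1 / 999 : ℝ)) / 4 ≤ δ → δ ≤ x ^ (-(1 / 1000 : ℝ)) → δ ≤ 1 / 2 →
            ∀ h : ℕ, 1 ≤ h → (h : ℝ) ≤ A →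
              |(∑ n ∈ Icc 1 ⌊2 * x⌋₊,
                  plateauCutoff (1 + δ) (2 - δ) δ (n / x) * (Λ n * Λ (n + h))) -
                  x * (∫ u, plateauCutoff (1 + δ) (2 - δ) δ u) * goldbachSingularSeries h *
                    (1 + if Nat.totient (2 ^ padicValNat 2 q) ∣ h then
                          (-1 : ℝ) ^ (h / Nat.totient (2 ^ padicValNat 2 q)) *
                            ∏ p ∈ (q / 2 ^ padicValNat 2 q).primeFactors.filter (fun p => ¬ p ∣ h),
                              (-1 : ℝ) / ((p : ℝ) - 2)
                        else 0)| ≤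
                K * ((h : ℝ) / (Nat.totient h : ℝ)) * x *
                  (Real.exp (-C * Real.sqrt (Real.log x / Real.log q * Real.log η)) +
                    Real.exp (-c₀ * Real.sqrt (Real.log x)) +
                    Real.log x / Real.log q * ρ η)) :
    ∀ C : ℝ, 1 ≤ C → ∀ A : ℝ, 0 < A → ∃ K : ℝ, 0 < K ∧
      ∀ (q : ℕ) [NeZero q], 2 ≤ q → ∀ χ : DirichletCharacter ℂ q, χ.IsPrimitive → χ.IsQuadratic →
        ∀ η : ℝ, 10 ≤ η → χ.LFunction ((1 - 1 / (η * Real.log q) : ℝ) : ℂ) = 0 →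
          ∀ V X : ℝ, 10 ≤ V → X = (q : ℝ) ^ V → ∀ h : ℕ, 1 ≤ h → (h : ℝ) ≤ A →
            |(∑ n ∈ Icc 1 ⌊X⌋₊, Λ n * Λ (n + h)) -
                X * goldbachSingularSeries h *
                  (1 + if Nat.totient (2 ^ padicValNat 2 q) ∣ h then
                        (-1 : ℝ) ^ (h / Nat.totient (2 ^ padicValNat 2 q)) *
                          ∏ p ∈ (q / 2 ^ padicValNat 2 q).primeFactors.filter (fun p => ¬ p ∣ h),
                            (-1 : ℝ) / ((p : ℝ) - 2)
                      else 0)| ≤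
              K * ((h : ℝ) / (Nat.totient h : ℝ)) * X *
                (Real.exp (-C * Real.sqrt (V * Real.log η)) +
                  Real.exp (-(c₀ / 2) * Real.sqrt (Real.log X)) +
                  V * ρ η) := by
  intro C hC A hA
  obtain ⟨K', hK', H'⟩ := H (2 * C) (by linarith) A hA
  obtain ⟨Kabs, hKabs, Habs⟩ := exists_rpow_neg_le_mul_exp_sqrt (show (0 : ℝ) < 1 / 8000 by norm_num) (c₀ / 2)
  refine ⟨K' + 30 * 24000 ^ 3 * (3 + A) * Kabs, by positivity, ?_⟩
  have hR : ∀ x X : ℝ, 1024 ≤ X → 0.89 * Real.log X ≤ Real.log x → Real.log x ≤ Real.log X →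
      Real.exp (-c₀ * Real.sqrt (Real.log x)) ≤ Real.exp (-(c₀ / 2) * Real.sqrt (Real.log X)) := by
    intro x X hX hlow _hup
    have hlogX : 0 ≤ Real.log X := Real.log_nonneg (by linarith)
    refine Real.exp_le_exp.mpr ?_
    -- `½ √log X ≤ √log x` since `log X ≤ 4 log x`
    have hsq : Real.sqrt (Real.log X) ≤ 2 * Real.sqrt (Real.log x) := by
      rw [show (2 : ℝ) = Real.sqrt 4 by rw [show (4 : ℝ) = 2 ^ 2 by norm_num, Real.sqrt_sq (by norm_num)],
        ← Real.sqrt_mul (by norm_num)]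
      exact Real.sqrt_le_sqrt (by linarith)
    nlinarith [Real.sqrt_nonneg (Real.log x), hc₀]
  exact pairCorrelation_smallShift_of_smoothed_generic₃ (Rh := fun x => Real.exp (-c₀ * Real.sqrt (Real.log x)))
    (Rc := fun X => Real.exp (-(c₀ / 2) * Real.sqrt (Real.log X)))
    (by linarith : (0 : ℝ) ≤ C) hA hρ hK' hKabs (fun X _ => (Real.exp_pos _).le) hR Habs H'

/-- **The smoothed dyadic form of Theorem 1.3 for shifts `h ≤ A` (classical second rate, general third
rate) from its core regime.** Small-shift form of `MatomakiMerikoski2023_smoothed_weak_of_core₃`; As `MatomakiMerikoski2023_smoothed_classical_of_core` (same proof: the instance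
`R(x) = exp(−c₀√log x)` of the degenerate-regime reduction), with the third rate `V' log⁶η/η` replaced
by `V' ρ(η)`, `ρ ≥ 0` and `ρ(η) ≥ c_ρ/η` on `[10, ∞)` (`MMSmoothing.smoothed_of_core_generic₃`).
[cite: MatomakiMerikoski2023, §7 first paragraph] -/
theorem MatomakiMerikoski2023_smoothed_smallShift_of_core₃ {ρ : ℝ → ℝ} (hρ : ∀ η : ℝ, 10 ≤ η → 0 ≤ ρ η)
    {cρ : ℝ} (hcρ : 0 < cρ) (hρlow : ∀ η : ℝ, 10 ≤ η → cρ / η ≤ ρ η) {c₀ : ℝ}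
    (Hcore : ∀ C : ℝ, 1 ≤ C → ∀ A : ℝ, 0 < A → ∃ η₀ K : ℝ, 0 < K ∧
      ∀ (q : ℕ) [NeZero q], 3 ≤ q → ∀ χ : DirichletCharacter ℂ q, χ.IsPrimitive → χ.IsQuadratic →
        ∀ η : ℝ, 10 ≤ η → η₀ ≤ η → χ.LFunction ((1 - 1 / (η * Real.log q) : ℝ) : ℂ) = 0 →
          ∀ x : ℝ, (q : ℝ) ^ (37 / 4 : ℝ) ≤ x → Real.log x / Real.log q * ρ η ≤ 1 →
            ∀ δ : ℝ, x ^ (-(1 / 999 : ℝ)) / 4 ≤ δ → δ ≤ x ^ (-(1 / 1000 : ℝ)) → δ ≤ 1 / 2 →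
            ∀ h : ℕ, 1 ≤ h → Even h → (h : ℝ) ≤ A →
              |(∑ n ∈ Icc 1 ⌊2 * x⌋₊,
                  plateauCutoff (1 + δ) (2 - δ) δ (n / x) * (Λ n * Λ (n + h))) -
                  x * (∫ u, plateauCutoff (1 + δ) (2 - δ) δ u) * goldbachSingularSeries h *
                    (1 + if Nat.totient (2 ^ padicValNat 2 q) ∣ h then
                          (-1 : ℝ) ^ (h / Nat.totient (2 ^ padicValNat 2 q)) *
                            ∏ p ∈ (q / 2 ^ padicValNat 2 q).primeFactors.filter (fun p => ¬ p ∣ h),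
                              (-1 : ℝ) / ((p : ℝ) - 2)
                        else 0)| ≤
                K * ((h : ℝ) / (Nat.totient h : ℝ)) * x *
                  (Real.exp (-C * Real.sqrt (Real.log x / Real.log q * Real.log η)) +
                    Real.exp (-c₀ * Real.sqrt (Real.log x)) +
                    Real.log x / Real.log q * ρ η)) :
    ∀ C : ℝ, 1 ≤ C → ∀ A : ℝ, 0 < A → ∃ K : ℝ, 0 < K ∧
      ∀ (q : ℕ) [NeZero q], 3 ≤ q → ∀ χ : DirichletCharacter ℂ q, χ.IsPrimitive → χ.IsQuadratic →
        ∀ η : ℝ, 10 ≤ η → χ.LFunction ((1 - 1 / (η * Real.log q) : ℝ) : ℂ) = 0 →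
          ∀ x : ℝ, (q : ℝ) ^ (37 / 4 : ℝ) ≤ x →
            ∀ δ : ℝ, x ^ (-(1 / 999 : ℝ)) / 4 ≤ δ → δ ≤ x ^ (-(1 / 1000 : ℝ)) → δ ≤ 1 / 2 →
            ∀ h : ℕ, 1 ≤ h → (h : ℝ) ≤ A →
              |(∑ n ∈ Icc 1 ⌊2 * x⌋₊,
                  plateauCutoff (1 + δ) (2 - δ) δ (n / x) * (Λ n * Λ (n + h))) -
                  x * (∫ u, plateauCutoff (1 + δ) (2 - δ) δ u) * goldbachSingularSeries h *
                    (1 + if Nat.totient (2 ^ padicValNat 2 q) ∣ h then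
                          (-1 : ℝ) ^ (h / Nat.totient (2 ^ padicValNat 2 q)) *
                            ∏ p ∈ (q / 2 ^ padicValNat 2 q).primeFactors.filter (fun p => ¬ p ∣ h),
                              (-1 : ℝ) / ((p : ℝ) - 2)
                        else 0)| ≤
                K * ((h : ℝ) / (Nat.totient h : ℝ)) * x *
                  (Real.exp (-C * Real.sqrt (Real.log x / Real.log q * Real.log η)) +
                    Real.exp (-c₀ * Real.sqrt (Real.log x)) +
                    Real.log x / Real.log q * ρ η) := by
  intro C hC A hA
  obtain ⟨η₀, K₁, hK₁, H₁⟩ := Hcore C hC A hA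
  obtain ⟨Ke, hKe, He⟩ := exists_rpow_neg_le_mul_exp_sqrt (show (0 : ℝ) < 1 / 1000 by norm_num) c₀
  exact smoothed_smallShift_of_core_generic₃ (R := fun x => Real.exp (-c₀ * Real.sqrt (Real.log x))) hA hρ hcρ hρlow
    (fun x _ => (Real.exp_pos _).le) hKe He hK₁ H₁

/-- **Corollary 1.1(i) from the CORE regime of the smoothed form of Theorem 1.3 for shifts `h ≤ A`
(constants depending on `A`), classical second rate, GENERAL third rate `V' ρ(η)`** (`ρ ≥ 0`, `ρ(η) ≥ c_ρ/η`, and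
`10 log η · ρ(η) ≪_C exp(−C√log η)` for every `C ≥ 1`): compose
`MatomakiMerikoski2023_smoothed_weak_of_core₃`, `MatomakiMerikoski2023_pairCorrelation_weak_of_smoothed₃`
(constant `c₀/2`) and `MatomakiMerikoski2023_fixedShift_of_weakPairCorrelation_generic`.
[cite: MatomakiMerikoski2023, Corollary 1.1(i), §2, §7 and the deduction after Theorem 1.4] -/
theorem MatomakiMerikoski2023_fixedShift_of_core_smallShift {ρ : ℝ → ℝ} (hρ : ∀ η : ℝ, 10 ≤ η → 0 ≤ ρ η)
    {cρ : ℝ} (hcρ : 0 < cρ) (hρlow : ∀ η : ℝ, 10 ≤ η → cρ / η ≤ ρ η)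
    (hρdecay : ∀ C : ℝ, 1 ≤ C → ∃ K₃ : ℝ, 0 < K₃ ∧ ∀ η : ℝ, 10 ≤ η →
      10 * Real.log η * ρ η ≤ K₃ * Real.exp (-C * Real.sqrt (Real.log η)))
    {c₀ : ℝ} (hc₀ : 0 < c₀)
    (Hcore : ∀ C : ℝ, 1 ≤ C → ∀ A : ℝ, 0 < A → ∃ η₀ K : ℝ, 0 < K ∧
      ∀ (q : ℕ) [NeZero q], 3 ≤ q → ∀ χ : DirichletCharacter ℂ q, χ.IsPrimitive → χ.IsQuadratic →
        ∀ η : ℝ, 10 ≤ η → η₀ ≤ η → χ.LFunction ((1 - 1 / (η * Real.log q) : ℝ) : ℂ) = 0 →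
          ∀ x : ℝ, (q : ℝ) ^ (37 / 4 : ℝ) ≤ x → Real.log x / Real.log q * ρ η ≤ 1 →
            ∀ δ : ℝ, x ^ (-(1 / 999 : ℝ)) / 4 ≤ δ → δ ≤ x ^ (-(1 / 1000 : ℝ)) → δ ≤ 1 / 2 →
            ∀ h : ℕ, 1 ≤ h → Even h → (h : ℝ) ≤ A →
              |(∑ n ∈ Icc 1 ⌊2 * x⌋₊,
                  plateauCutoff (1 + δ) (2 - δ) δ (n / x) * (Λ n * Λ (n + h))) -
                  x * (∫ u, plateauCutoff (1 + δ) (2 - δ) δ u) * goldbachSingularSeries h *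
                    (1 + if Nat.totient (2 ^ padicValNat 2 q) ∣ h then
                          (-1 : ℝ) ^ (h / Nat.totient (2 ^ padicValNat 2 q)) *
                            ∏ p ∈ (q / 2 ^ padicValNat 2 q).primeFactors.filter (fun p => ¬ p ∣ h),
                              (-1 : ℝ) / ((p : ℝ) - 2)
                        else 0)| ≤
                K * ((h : ℝ) / (Nat.totient h : ℝ)) * x *
                  (Real.exp (-C * Real.sqrt (Real.log x / Real.log q * Real.log η)) +
                    Real.exp (-c₀ * Real.sqrt (Real.log x)) +
                    Real.log x / Real.log q * ρ η)) :
    MatomakiMerikoski2023_fixedShift :=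
  MatomakiMerikoski2023_fixedShift_of_weakPairCorrelation_smallShift hρ hρdecay (half_pos hc₀)
    (MatomakiMerikoski2023_pairCorrelation_smallShift_of_smoothed₃ hρ hc₀
      (MatomakiMerikoski2023_smoothed_smallShift_of_core₃ hρ hcρ hρlow Hcore))

/-- **Corollary 1.1(i) from the core regime of the smoothed form of Theorem 1.3 with the classical second
rate and the third rate `V' η^{κ−1}`, `0 < κ < 1`**, small-shift form (`h ≤ A`) — the target statement for a proof of §§5–7 of the
source whose treatment of Lemma 2.1 (the range `4X/|h|^{1/10} < m ≤ 4X/z` of its proof, outside the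
stated range of Lemma 3.1(ii)) loses a factor `e^{O(u)} = η^{O(1)·c}` (`u ≤ c log η`) in the third rate:
any power saving `η^{κ−1}` in place of the printed `log⁶η/η` still gives Corollary 1.1(i) AS PRINTED
(on its range `V ≤ 10 log η` one has `V η^{κ−1} ≤ 10 log η · e^{−(1−κ) log η} ≪_C e^{−C√log η}`).
Instance `ρ(η) = η^{κ−1}` of `MatomakiMerikoski2023_fixedShift_of_core_smallShift`. THIS is the target statement
for a proof of Corollary 1.1(i) through §§5–7 with the tree's Lemma-2.1 substitutes.
[cite: MatomakiMerikoski2023, Corollary 1.1(i), §2, §7 and the deduction after Theorem 1.4] -/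
theorem MatomakiMerikoski2023_fixedShift_of_core_smallShift_rpow {κ : ℝ} (hκ0 : 0 < κ) (hκ1 : κ < 1)
    {c₀ : ℝ} (hc₀ : 0 < c₀)
    (Hcore : ∀ C : ℝ, 1 ≤ C → ∀ A : ℝ, 0 < A → ∃ η₀ K : ℝ, 0 < K ∧
      ∀ (q : ℕ) [NeZero q], 3 ≤ q → ∀ χ : DirichletCharacter ℂ q, χ.IsPrimitive → χ.IsQuadratic →
        ∀ η : ℝ, 10 ≤ η → η₀ ≤ η → χ.LFunction ((1 - 1 / (η * Real.log q) : ℝ) : ℂ) = 0 →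
          ∀ x : ℝ, (q : ℝ) ^ (37 / 4 : ℝ) ≤ x → Real.log x / Real.log q * η ^ (κ - 1) ≤ 1 →
            ∀ δ : ℝ, x ^ (-(1 / 999 : ℝ)) / 4 ≤ δ → δ ≤ x ^ (-(1 / 1000 : ℝ)) → δ ≤ 1 / 2 →
            ∀ h : ℕ, 1 ≤ h → Even h → (h : ℝ) ≤ A →
              |(∑ n ∈ Icc 1 ⌊2 * x⌋₊,
                  plateauCutoff (1 + δ) (2 - δ) δ (n / x) * (Λ n * Λ (n + h))) -
                  x * (∫ u, plateauCutoff (1 + δ) (2 - δ) δ u) * goldbachSingularSeries h *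
                    (1 + if Nat.totient (2 ^ padicValNat 2 q) ∣ h then
                          (-1 : ℝ) ^ (h / Nat.totient (2 ^ padicValNat 2 q)) *
                            ∏ p ∈ (q / 2 ^ padicValNat 2 q).primeFactors.filter (fun p => ¬ p ∣ h),
                              (-1 : ℝ) / ((p : ℝ) - 2)
                        else 0)| ≤
                K * ((h : ℝ) / (Nat.totient h : ℝ)) * x *
                  (Real.exp (-C * Real.sqrt (Real.log x / Real.log q * Real.log η)) +
                    Real.exp (-c₀ * Real.sqrt (Real.log x)) +
                    Real.log x / Real.log q * η ^ (κ - 1))) :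
    MatomakiMerikoski2023_fixedShift :=
  MatomakiMerikoski2023_fixedShift_of_core_smallShift (ρ := fun η : ℝ => η ^ (κ - 1))
    (fun η hη => Real.rpow_nonneg (by linarith) _) one_pos
    (fun η hη => MatomakiMerikoski.one_div_le_rpow_sub_one hκ0.le (by linarith))
    (fun C _ => MatomakiMerikoski.exists_ten_mul_log_mul_rpow_le hκ1 C) hc₀ Hcore


end Literature.Barriers.Parity

end
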